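import Mathlib
import Literature.MathematicalPhysics.QuantumFieldTheory.King1986.EffectiveLaplacianSymbol
import Literature.MathematicalPhysics.QuantumFieldTheory.King1986.AliasSums
import Literature.MathematicalPhysics.QuantumFieldTheory.Balaban1983to89.Beta.LargeLWindow

/-!
# Beta / WoodburyFibre — the Woodbury (block-averaging) correction `R⊥` of the one-step fluctuation propagator is
`O(L⁻²)` POINTWISE with `O(L⁻³)` / `O(L⁻⁴)` lattice derivatives, UNIFORMLY IN THE VOLUME and in the coupling `a`:
a momentum-space (Bloch-fibre) certificate for the scalar site-averaged model, `d = 4`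

HONEST FRAMING (verbatim, page 1 of everything this cell writes): discharging `BetaPertH` makes Bałaban's UV
stability UNCONDITIONAL — a real constructive-QFT result; it is NOT the continuum limit and NOT the Clay problem.
ABSOLUTE RULE (verbatim): no internally-minted statement may enter as a cited fact.  Every hypothesis is either
kernel-proved in this package or a verbatim quotation of a PUBLISHED theorem with page reference; the manuscripts under
audit are NOT citable for their own disputed steps, programme-internal claims never.  THIS MODULE quotes nothing: every
statement below is a Mathlib-elementary theorem about ONE explicit finite matrix; the `[cite: King1986 …]` tags locate
the printed TECHNIQUE (alias sums), they are not hypotheses.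

SETTING (all of it imported from `King1986/TorusBlockForm`, `King1986/EffectiveLaplacianSymbol`).  Fine torus
`Tor (fine N M)` (`fine N M μ = N·M μ`; `N` = block side, the cell's `L`), coarse torus `Tor M`, block-mean projector
`blockProj N M` (`= Q*Q`, orthogonal), King's operator `fineOp N M a c m2 = c·(−Δ₁) + m2 + a·blockProj` in KING SCALING
`c = N²`; fine momenta `p`, coarse momentum `q = red p`, fibre `fib N M q = {pOf (m,q) : m ∈ (Fin N)^d}` (the `N^d`
aliases `p′ + 2πm`), central alias `z q = pOf (0,q)`, block form factor `u N M p`, symbol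
`σ(p) = lapSym (fine N M) (N²) m2 p = m2 + N² Σ_μ (2 − 2cos p_μ)`, `S(q) = Sfib = Σ_{fib q} |u|²/σ`,
`κ(q) = kap = a/(1 + a S(q))` and King's fibre inverse `hat_fineOp_inv` [cite: King1986, (4.33) p.673].

WHAT IS PROVED.
* §5 (E) **EXACT DECOMPOSITION** (`fineOp_inv_decomposition`; any `d`, any periods, `a ≥ 0`, `m2 > 0`, `N ≥ 1`):
    `G(x,x′) := (fineOp N M a (N²) m2)⁻¹ x x′ = GfreePerp (x′ − x) + V⁻¹·(m2 + a)⁻¹ − R⊥(x,x′)`,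
  `V = #Tor (fine N M)`, `GfreePerp w = V⁻¹ Σ_{p ≠ 0} e^{ip·w}/σ(p)` (the MEAN-ZERO free massive torus Green function — no
  `p = 0` term), `R⊥(x,x′) = Rperp = V⁻¹ Σ_{q ≠ 0} κ(q) A_q(x) conj(A_q(x′))`, `A_q(x) = famp = Σ_{p ∈ fib q} e^{−ip·x} u(p)/σ(p)`.
  Mechanism: Fourier inversion on the fine torus (`kernel_inversion`) of King's fibrewise inverse, plus the observation
  that on the ZERO coarse fibre every off-centre alias has `u = 0` (`u_pOf_zero_eq_zero`), so the `q = 0` fibre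
  contributes EXACTLY the zero mode `V⁻¹(m2 + a)⁻¹` (`famp_zero`, `Sfib_zero`): the would-be `m2 → 0` singularity of the
  free part is removed identically, not estimated.
* §4 (B0) **FLAT BOUND**, `d = 4`, equal periods `M = cM M₀ = (M₀,M₀,M₀,M₀)`: for all `x, x′`, all `a > 0`, `m2 ≥ 0`,
  `N ≥ 1`, `M₀ ≥ 1`:  `‖R⊥(x,x′)‖ ≤ woodburyD m2 / N⁴` (`norm_Rperp_le`),
  `woodburyD m2 = 5/2 + 2·600²·(π²/4)⁴·(4π² + m2)` — free of `N`, `M₀`, `a`.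
* §6 (B1) **ONE LATTICE DIFFERENCE**: `‖R⊥(x + e_μ, x′) − R⊥(x,x′)‖ ≤ woodburyD1 m2 / N⁵` (`norm_dRperp_le`);
  (B2) **TWO**: `‖∇_μ^x ∇_ν^{x′} R⊥(x,x′)‖ ≤ woodburyD2 m2 / N⁶` (`norm_ddRperp_le`); same uniformity, explicit constants
  (`mixedE`, `doubleE`).
  ENGINE (§§1–3, any `d`).  Per fibre `q ≠ 0`: `κ(q) ≤ σ₀/|u₀|²` with `σ₀ = σ(z q)`, `|u₀|² ≥ (4/π²)^d` (`kap_le`,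
  King (4.37)); `|A_q(x)| ≤ |u₀|/σ₀ + Y(q)` (`norm_famp_le`) where the OFF-CENTRE ALIAS SUM
  `Y(q) = Σ_{m ≠ 0} |u(p′+2πm)|/σ(p′+2πm) ≤ aliasC d = ((d+3)^d − 1)/4` (`= 600` for `d = 4`; `Yoff_le`, `offCentre_sum_le`)
  UNIFORMLY in `N`, `q`, `m2 ≥ 0` — from the folded alias index `m̂ = min(m, N−m)`, `S_ξ(x + 2πm) ≥ 4m̂²` (§1, Jordan) and
  the product majorant `|u|/σ ≤ ¼ Π_μ m̂_μ^{−(1+2/d)}` over the active coordinates (§2; King's (4.20)–(4.22) device,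
  here with every constant computed); hence `‖κ A_q(x) conj A_q(x′)‖ ≤ 2/σ₀ + const` (`fibre_term_le`).  In `d = 4` the
  small denominators are summed by shells: `σ₀(q) ≥ 16‖v(q)‖_∞²/M₀²` (`lapSym_z_ge_supNorm`, `v(q)` = centred
  representative) and `Σ_{q ≠ 0} 1/σ₀(q) ≤ (5/4)·M₀⁴` (`sum_inv_lapSym_z_le`, via the lead's `sum_inv_sq_window_le`),
  against `V = N⁴M₀⁴` (`card_tor_fine`).  Each lattice difference costs `|e^{ip·e_μ} − 1| ≤ √σ(p)/N`
  (`norm_chi_unitVec_sub_one_le`), trading one power of the small denominator for `1/N`: half-power alias constant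
  `aliasC2 d = ((2d+3)^d − 1)/2` (`= 7320`), `Σ_{q ≠ 0} 1/√σ₀(q) ≤ (5/2)·M₀⁴` (`sum_inv_sqrt_lapSym_z_le`), and the doubly
  differenced kernel has NO small denominator at all (`double_term_le`).
* §7 (E₀) **THE MASSLESS ENDPOINT** (`fineOp_inv_zero_decomposition`; `a > 0`, `N ≥ 1`, any `d`, any periods): the same
  decomposition AT `m2 = 0` with the massless mean-zero Green function `GfreePerp N M 0` and the zero mode `V⁻¹a⁻¹`, and
  the invertibility `isUnit_fineOp_zero` of `N²(−Δ₁) + a·Q*Q` itself — both obtained from the MATRIX identity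
  `Gdec(m2)·fineOp(m2) = 1` (`m2 > 0`) by entrywise continuity at `m2 = 0` (§7 proves it term by term: `σ(p) > 0` for
  `p ≠ 0`, `lapSym_pos_of_ne_zero`; `1 + aS(q) > 0`) and uniqueness of limits along `m2 → 0⁺` (`Gdec_mul_fineOp_zero`); no
  separate kernel / connectedness argument is needed.
* §8 (E_lat), (R7)(i) **IN LATTICE UNITS, LITERALLY**.  With unit lattice spacing, block side `L = N` and Bałaban's weighted
  coarse pairing (`Q*` = spreading) the one-step operator is `−Δ₁ + m² + aQ*Q = fineOp N M a 1 m²`, and KING SCALING is the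
  identity `fineOp N M (N²a) (N²) (N²m²) = N² • fineOp N M a 1 m²` (`fineOp_scale`).  Hence (`latticeInv_decomposition`, every
  `a > 0`, every `m2 ≥ 0` INCLUDING `m2 = 0`):
    `Γ_lat(x,x′) := (fineOp N M a 1 m²)⁻¹ x x′ = C⊥(x′ − x) + V⁻¹(m² + a)⁻¹ − R_W(x,x′)`,
  `C⊥ = GfreeLat` = the unit-lattice mean-zero free Green function `V⁻¹Σ_{p≠0} e^{ip·w}/(m² + Σ_μ(2 − 2cos p_μ))`,
  `R_W = RW = N²·R⊥(a_K = N²a, m²_K = N²m²)`; and in `d = 4` (equal periods `M₀`), for ALL `x, x′`, every `a > 0`, every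
  volume: `‖R_W‖ ≤ woodburyD(N²m²)/L²` (`norm_RW_le`), `‖∇_μ R_W‖ ≤ woodburyD1(N²m²)/L³` (`norm_dRW_le`),
  `‖∇_μ∇′_ν R_W‖ ≤ woodburyD2(N²m²)/L⁴` (`norm_ddRW_le`); MASSLESS: the three bounds with the absolute constants
  `woodburyD 0`, `woodburyD1 0`, `woodburyD2 0` (`norm_RW_zero_le`).  These are RULING (R7)(i)'s `D₀L⁻²`, `D₁L⁻³`, `D₂L⁻⁴`
  — `(L,k)`-free (the scalar one-step operator does not see `k`), volume-free, `a`-free, valid at all separations (not only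
  `≤ L`: beyond one block `R_W ≈ C⊥` and both are `O(L⁻²)`).  The flat bound is what the lead's window input `hin` of
  `Beta/WindowInterface` consumes after multiplication by the free legs (`K − K₀ ≈ 2·C·R_W`, `C ~ |w|⁻²`); that product step and
  the interface instance are the assembly owner's, not this file's.
* §9 (v1.1, append-only) HERMITIAN SYMMETRY `R⊥(x′,x) = conj R⊥(x,x′)` (`Rperp_swap`, `RW_swap`), the `x′`-differences
  `dRperp'`, `dRW'` and their bounds `‖∇′_ν R⊥‖ ≤ woodburyD1/N⁵` (`norm_dRperp'_le`), `‖∇′_ν R_W‖ ≤ woodburyD1(N²m²)/L³`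
  (`norm_dRW'_le`); `norm_RW_zero_le'` = the massless (R7)(i) list with one difference on EITHER leg.

WHAT IT DOES NOT GIVE (located, not claimed).  (i) Only the SCALAR `U = 1` SITE-averaged model with unit weights and,
for the `d = 4` sums, EQUAL periods `M₀` in the four directions (general `M` is routine and not done); bond / covariant
averaging `Δ_k(U)` untouched.  (ii) For `m2 > 0` the lattice constants are `woodburyD(N²m²)` etc., monotone in the King
mass `N²m²`: uniform in `L` only for `m² ≲ L⁻²` — the cell's use is the massless case `m2 = 0` (absolute constants), a
positive `m²` being at most an IR regulator to be removed first.  (iii) The bridge to pv23's `TorusG0Decay.torusOp` /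
`TorusG0Kernel.G0` (`lap ∘ coupling` and `B5Blocks16` blocks versus King's `lapF` / `TorusBlockForm.blockOf`) is NOT in
this file: it is the sibling `Beta/WoodburyFibreBridge.lean` (p181298: `torusOp_eq_fineOp`, `G0_decomposition`,
`G0_woodbury_bounds` — the same operator in King units `c = (n+1)²`, `m2 = 0`).
(iv) Nothing about the `C_k` legs (`Leg.err`), the far region, the table identification, `β`, `κ_Bal` or its sign.
CONTEXT ONLY (printed TECHNIQUE / TYPE of statement, never used as a fact): the alias-sum estimates King, *The U(1) Higgs
model. I*, Commun. Math. Phys. 102 (1986) 649–677, §4 (4.19)–(4.22) p. 672, (4.33)–(4.37) p. 674 [King1986] (LOCATOR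
CORRECTED, docstring only, b2b-balaban-beta-an5 gen 15 after asym1's NOTE «KING 1986 LOCATOR SLIP»: gen 5 printed Part II's
volume / page range «103 (1986) 323–349» and a non-existent bib key `King1986U1Higgs3dI`; the displays are Part I's, re-checked
on the held text layer pp. 672/674; the `[cite: King1986, …]` tags of §§1–7 were and are keyed to Part I correctly); Bałaban,
Commun. Math. Phys. 89 (1983) 571–597 (1.13)–(1.16) [Balaban1983RegularityDecay] prints `k`-uniform bounds for `C^{(k)}` at
FIXED `L`
— the explicit `L`-tracking here is beyond the printed bookkeeping (cell record G-sb12-5, the AF-0-L road).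
Cell records: RULING (R7) (journal l. 5402; BETA-SPEC v1.9f §7.12(b)) item (i); AN5.md rows B6a/B6b/B7.  Unit
`b2b-balaban-beta-an5-g5` (DEDICATED β sub-cell row BETA-an5, gen 5; journal node BETA-an5-WOODBURY-FIBRE); staged
byte-identically under `HOME/lean/BalabanYm4/`.  Value = kernel certificate of a located estimate for a toy operator, NOT
summit progress.
-/

noncomputable section

open Finset Real Matrix
open scoped BigOperators ComplexConjugate

namespace Literature.MathematicalPhysics.QuantumFieldTheory.Balaban1983to89.Beta.WoodburyFibre

open Literature.MathematicalPhysics.QuantumFieldTheory.King1986 (sum_range_rpow_neg_le)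
open Literature.MathematicalPhysics.QuantumFieldTheory.King1986.Torus
open Literature.MathematicalPhysics.QuantumFieldTheory.Balaban1983to89.B5Prop11Plancherel (Tor fine chi sOf
  abs_sOf_le conj_chi chi_zero_left chi_add_left)
open Literature.MathematicalPhysics.QuantumFieldTheory.Balaban1983to89.B4Strip (S1r Sxir DeltaXir shiftr uFactorr Ur
  Sxir_eq Sxir_nonneg Sxir_le S1r_nonneg uFactorr_nonneg Ur_nonneg DeltaXir_nonneg)
open Literature.MathematicalPhysics.QuantumFieldTheory.Balaban1983to89.B5Prop11Leaves (uFactorr_le_one S1r_le_four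
  DeltaXir_pos)
open Literature.MathematicalPhysics.QuantumFieldTheory.Balaban1983to89.B5Block118 (pOf pOf_injective)

variable {d : ℕ}

/-! ## §1 One coordinate: the folded alias index `m̂ = min(m, N − m)` and `S_ξ(x + 2πm) ≥ 4m̂²` -/

/-- The FOLDED alias index `m̂ = min(m, N − m)` of `m ∈ {0,…,N−1}` (distance of `m` to `Nℤ`). [folklore] -/
def fold (N m : ℕ) : ℕ := min m (N - m)

/-- `0̂ = 0`. [folklore] -/
theorem fold_zero (N : ℕ) : fold N 0 = 0 := by simp [fold]

/-- `m̂ ≥ 1` for `1 ≤ m ≤ N − 1`. [folklore] -/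
theorem one_le_fold {N m : ℕ} (h1 : 1 ≤ m) (h2 : m + 1 ≤ N) : 1 ≤ fold N m := by
  unfold fold; omega

/-- `m̂ ≤ m`. [folklore] -/
theorem fold_le_left (N m : ℕ) : fold N m ≤ m := min_le_left _ _

/-- `m̂ ≤ N − m`. [folklore] -/
theorem fold_le_right (N m : ℕ) : fold N m ≤ N - m := min_le_right _ _

/-- **The off-centre aliases carry no small denominators, quantitatively**: for `1 ≤ m ≤ N − 1` and `|x| ≤ π`,
`S_ξ(x + 2πm) = 4N² sin²((x+2πm)/2N) ≥ 4·min(m, N−m)²` (Jordan's inequality on `[0, π/2]` and its mirror image).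
[folklore] -/
theorem four_mul_fold_sq_le_Sxir {N m : ℕ} (h1 : 1 ≤ m) (h2 : m + 1 ≤ N) {x : ℝ} (hx : |x| ≤ π) :
    4 * (fold N m : ℝ) ^ 2 ≤ Sxir N (x + 2 * π * m) := by
  rw [Sxir_eq]
  have hpi := Real.pi_pos
  have hm1 : (1 : ℝ) ≤ m := by exact_mod_cast h1
  have hmN : (m : ℝ) + 1 ≤ N := by exact_mod_cast h2
  have hN0 : (0 : ℝ) < N := by linarith
  obtain ⟨hx1, hx2⟩ := abs_le.mp hx
  have hfl : (fold N m : ℝ) ≤ m := by exact_mod_cast fold_le_left N m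
  have hfr : (fold N m : ℝ) ≤ (N : ℝ) - m := by
    have h := fold_le_right N m
    have hmle : m ≤ N := by omega
    have : ((N - m : ℕ) : ℝ) = (N : ℝ) - m := Nat.cast_sub hmle
    rw [← this]; exact_mod_cast h
  have hf0 : (0 : ℝ) ≤ fold N m := Nat.cast_nonneg _
  set θ := (x + 2 * π * m) / (2 * N) with hθ
  -- the key bound `m̂/N ≤ sin θ`
  have key : (fold N m : ℝ) / N ≤ Real.sin θ := by
    rcases le_total θ (π / 2) with h | h
    · -- Jordan on `[0, π/2]`: `sin θ ≥ (2/π)θ ≥ (2m−1)/N ≥ m/N ≥ m̂/N`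
      have hθ0 : 0 ≤ θ := by
        rw [hθ]; apply div_nonneg _ (by positivity); nlinarith
      have hj := Real.mul_le_sin hθ0 h
      have h3 : (2 * (m : ℝ) - 1) / N ≤ 2 / π * θ := by
        rw [hθ, div_le_iff₀ hN0]
        have e : 2 / π * ((x + 2 * π * m) / (2 * N)) * N = (x + 2 * π * m) / π := by
          field_simp
        rw [e, le_div_iff₀ hpi]
        nlinarith
      have h4 : (fold N m : ℝ) / N ≤ (2 * (m : ℝ) - 1) / N := by
        apply div_le_div_of_nonneg_right _ hN0.le; linarith
      linarith
    · -- mirror image: `sin θ = sin(π − θ)`, `π − θ ∈ [0, π/2]`, `(2/π)(π−θ) ≥ (2(N−m)−1)/N ≥ (N−m)/N ≥ m̂/N`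
      have hθπ : θ ≤ π := by
        rw [hθ, div_le_iff₀ (by positivity)]; nlinarith
      have h0 : 0 ≤ π - θ := by linarith
      have hle : π - θ ≤ π / 2 := by linarith
      have hj := Real.mul_le_sin h0 hle
      rw [Real.sin_pi_sub] at hj
      have h3 : (2 * ((N : ℝ) - m) - 1) / N ≤ 2 / π * (π - θ) := by
        rw [hθ, div_le_iff₀ hN0]
        have e : 2 / π * (π - (x + 2 * π * m) / (2 * N)) * N = (2 * π * N - (x + 2 * π * m)) / π := by
          field_simp
        rw [e, le_div_iff₀ hpi]
        nlinarith
      have hNm1 : (1 : ℝ) ≤ (N : ℝ) - m := by linarith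
      have h4 : (fold N m : ℝ) / N ≤ (2 * ((N : ℝ) - m) - 1) / N := by
        apply div_le_div_of_nonneg_right _ hN0.le; linarith
      linarith
  have h5 : ((fold N m : ℝ) / N) ^ 2 ≤ Real.sin θ ^ 2 := pow_le_pow_left₀ (by positivity) key 2
  calc 4 * (fold N m : ℝ) ^ 2 = 4 * (N : ℝ) ^ 2 * ((fold N m : ℝ) / N) ^ 2 := by field_simp
    _ ≤ 4 * (N : ℝ) ^ 2 * Real.sin θ ^ 2 := by gcongr

/-- Hence one alias-weight factor decays in the folded index: `|v(x; m)|² = S₁(x)/S_ξ(x+2πm) ≤ 1/m̂²` for `m ≠ 0`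
(`S₁ ≤ 4`). [folklore] -/
theorem uFactorr_le_inv_fold_sq {N m : ℕ} (h1 : 1 ≤ m) (h2 : m + 1 ≤ N) {x : ℝ} (hx : |x| ≤ π) :
    uFactorr N m x ≤ ((fold N m : ℝ) ^ 2)⁻¹ := by
  have hm0 : m ≠ 0 := by omega
  have hf : (1 : ℝ) ≤ fold N m := by exact_mod_cast one_le_fold h1 h2
  have hS := four_mul_fold_sq_le_Sxir h1 h2 hx
  have hpos : 0 < Sxir N (x + 2 * π * m) := lt_of_lt_of_le (by positivity) hS
  unfold uFactorr
  rw [if_neg hm0, div_le_iff₀ hpos]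
  have h4 := S1r_le_four x
  calc S1r x ≤ 4 := h4
    _ = ((fold N m : ℝ) ^ 2)⁻¹ * (4 * (fold N m : ℝ) ^ 2) := by field_simp
    _ ≤ ((fold N m : ℝ) ^ 2)⁻¹ * Sxir N (x + 2 * π * m) := by gcongr

/-! ## §2 The off-centre alias sum `Σ_{m ≠ 0} |u(p′+2πm)|/σ(p′+2πm) ≤ ((d+3)^d − 1)/4`, uniformly in `N`, `p′`, `m² ≥ 0` -/

/-- per-coordinate majorant of `|v(x;m)|`: `1` for `m = 0`, `1/m̂` otherwise. [folklore] -/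
def hfac (N : ℕ) (j : ℕ) : ℝ := if j = 0 then 1 else ((fold N j : ℝ))⁻¹

/-- per-coordinate summable majorant: `1` for `m = 0`, `m̂^{−s}` otherwise. [folklore] -/
def gfac (N : ℕ) (s : ℝ) (j : ℕ) : ℝ := if j = 0 then 1 else (fold N j : ℝ) ^ (-s)

/-- the exponent `s = 1 + 2/d`. [folklore] -/
def sExp (d : ℕ) : ℝ := 1 + 2 / (d : ℝ)

/-- `hfac ≥ 0`. [folklore] -/
theorem hfac_nonneg (N j : ℕ) : 0 ≤ hfac N j := by
  unfold hfac; split_ifs <;> positivity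

/-- `gfac ≥ 0`. [folklore] -/
theorem gfac_nonneg (N : ℕ) (s : ℝ) (j : ℕ) : 0 ≤ gfac N s j := by
  unfold gfac; split_ifs
  · exact zero_le_one
  · exact rpow_nonneg (Nat.cast_nonneg _) _

/-- `|u(p′ + 2πm)|² = Π_μ |v(p′_μ; m_μ)|² ≤ Π_μ hfac(m_μ)²`. [folklore] -/
theorem Ur_le_prod_hfac_sq {N : ℕ} (hN : 1 ≤ N) (m : Fin d → Fin N) {s : Fin d → ℝ} (hs : ∀ μ, |s μ| ≤ π) :
    Ur N m s ≤ ∏ μ, hfac N (m μ : ℕ) ^ 2 := by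
  unfold Ur
  refine Finset.prod_le_prod (fun μ _ => uFactorr_nonneg _ _ _) fun μ _ => ?_
  unfold hfac
  by_cases h0 : (m μ : ℕ) = 0
  · rw [h0, if_pos rfl, one_pow]; exact uFactorr_le_one N hN 0 (s μ)
  · rw [if_neg h0, inv_pow]
    exact uFactorr_le_inv_fold_sq (Nat.one_le_iff_ne_zero.mpr h0) (m μ).isLt (hs μ)

/-- `Δ(p′ + 2πm) + m² ≥ S_ξ(p′_ν + 2πm_ν) ≥ 4 m̂_ν²` for every coordinate `ν` with `m_ν ≠ 0`. [folklore] -/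
theorem four_mul_fold_sq_le_DeltaXir {N : ℕ} (m : Fin d → Fin N) {m2 : ℝ} (hm2 : 0 ≤ m2) {s : Fin d → ℝ}
    (hs : ∀ μ, |s μ| ≤ π) (ν : Fin d) (hν : (m ν : ℕ) ≠ 0) :
    4 * (fold N (m ν : ℕ) : ℝ) ^ 2 ≤ DeltaXir N m2 (shiftr N m s) := by
  have h1 := four_mul_fold_sq_le_Sxir (Nat.one_le_iff_ne_zero.mpr hν) (m ν).isLt (hs ν)
  unfold DeltaXir shiftr
  have h2 : Sxir N (s ν + 2 * π * ((m ν : ℕ) : ℝ)) ≤ ∑ μ, Sxir N (s μ + 2 * π * ((m μ : ℕ) : ℝ)) :=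
    Finset.single_le_sum (f := fun μ => Sxir N (s μ + 2 * π * ((m μ : ℕ) : ℝ))) (fun μ _ => Sxir_nonneg N _)
      (Finset.mem_univ ν)
  linarith

/-- **Termwise majorant.**  For an off-centre alias `m ≠ 0` (`d ≥ 1`, `N ≥ 1`, `m² ≥ 0`, `|p′_μ| ≤ π`):
`√(|u(p′+2πm)|²) / (Δ(p′+2πm) + m²) ≤ ¼ Π_μ gfac(m_μ)` with exponent `s = 1 + 2/d` — each ACTIVE coordinate pays
`1/m̂_μ` from the weight and `m̂_max^{−2/d} ≤ m̂_μ^{−2/d}` from the denominator `≥ 4 m̂_max²` (King's "by inspection",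
(4.22) p. 672, in folded form). [cite: King1986, (4.20)–(4.22) p.672] -/
theorem sqrtUr_div_le_prod_gfac (hd : 0 < d) {N : ℕ} [NeZero N] (hN : 1 ≤ N) (m : Fin d → Fin N)
    (hm : m ≠ fun _ => 0) {m2 : ℝ} (hm2 : 0 ≤ m2) {s : Fin d → ℝ} (hs : ∀ μ, |s μ| ≤ π) {y : ℝ} (hy0 : 0 ≤ y)
    (hy : y ^ 2 = Ur N m s) :
    y / DeltaXir N m2 (shiftr N m s) ≤ (1 / 4) * ∏ μ, gfac N (sExp d) (m μ : ℕ) := by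
  have hdR : (0 : ℝ) < d := by exact_mod_cast hd
  -- J := max_μ m̂_μ, attained at some ν, and ≥ 1
  obtain ⟨ν, -, hν⟩ := Finset.exists_mem_eq_sup (Finset.univ : Finset (Fin d))
    (Finset.univ_nonempty_iff.mpr ⟨⟨0, hd⟩⟩) (fun μ => fold N (m μ : ℕ))
  set J : ℕ := Finset.univ.sup (fun μ => fold N (m μ : ℕ)) with hJdef
  have hJge : ∀ μ, fold N (m μ : ℕ) ≤ J := fun μ =>
    Finset.le_sup (f := fun μ => fold N (m μ : ℕ)) (Finset.mem_univ μ)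
  obtain ⟨μ₀, hμ₀⟩ : ∃ μ, (m μ : ℕ) ≠ 0 := by
    by_contra hcon
    push Not at hcon
    exact hm (funext fun μ => Fin.ext (by simpa using hcon μ))
  have hJ1 : 1 ≤ J := le_trans (one_le_fold (Nat.one_le_iff_ne_zero.mpr hμ₀) (m μ₀).isLt) (hJge μ₀)
  have hν0 : (m ν : ℕ) ≠ 0 := by
    intro h0
    rw [h0, fold_zero] at hν
    omega
  have hJR : (1 : ℝ) ≤ J := by exact_mod_cast hJ1
  have hJpos : (0 : ℝ) < J := by linarith
  -- denominator ≥ 4J²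
  have hden : 4 * (J : ℝ) ^ 2 ≤ DeltaXir N m2 (shiftr N m s) := by
    have := four_mul_fold_sq_le_DeltaXir m hm2 hs ν hν0
    rwa [← hν] at this
  have hden_pos : 0 < DeltaXir N m2 (shiftr N m s) := lt_of_lt_of_le (by positivity) hden
  -- numerator ≤ Π hfac
  have hprod0 : 0 ≤ ∏ μ, hfac N (m μ : ℕ) := Finset.prod_nonneg fun μ _ => hfac_nonneg N _
  have hnum : y ≤ ∏ μ, hfac N (m μ : ℕ) := by
    have h := Ur_le_prod_hfac_sq hN m hs
    rw [← hy, Finset.prod_pow] at h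
    exact (pow_le_pow_iff_left₀ hy0 hprod0 two_ne_zero).mp h
  -- (Π hfac) · J^{−2} ≤ Π gfac
  have hsplit : (∏ μ, hfac N (m μ : ℕ)) * ((J : ℝ) ^ (2 : ℕ))⁻¹ ≤ ∏ μ, gfac N (sExp d) (m μ : ℕ) := by
    have hJpow : ((J : ℝ) ^ (2 : ℕ))⁻¹ = ∏ _μ : Fin d, (J : ℝ) ^ (-(2 / (d : ℝ))) := by
      rw [Finset.prod_const, Finset.card_univ, Fintype.card_fin,
        ← Real.rpow_natCast ((J : ℝ) ^ (-(2 / (d : ℝ)))) d, ← Real.rpow_mul hJpos.le]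
      have e : -(2 / (d : ℝ)) * ((d : ℕ) : ℝ) = -(2 : ℝ) := by
        field_simp
      rw [e, Real.rpow_neg hJpos.le, Real.rpow_two]
    rw [hJpow, ← Finset.prod_mul_distrib]
    refine Finset.prod_le_prod (fun μ _ => mul_nonneg (hfac_nonneg N _) (rpow_nonneg hJpos.le _)) fun μ _ => ?_
    have hJd1 : (J : ℝ) ^ (-(2 / (d : ℝ))) ≤ 1 :=
      Real.rpow_le_one_of_one_le_of_nonpos hJR (by
        have : 0 ≤ 2 / (d : ℝ) := by positivity
        linarith)
    unfold hfac gfac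
    by_cases h0 : (m μ : ℕ) = 0
    · rw [if_pos h0, if_pos h0, one_mul]; exact hJd1
    · rw [if_neg h0, if_neg h0]
      have hf1 : (1 : ℝ) ≤ fold N (m μ : ℕ) := by
        exact_mod_cast one_le_fold (Nat.one_le_iff_ne_zero.mpr h0) (m μ).isLt
      have hfpos : (0 : ℝ) < fold N (m μ : ℕ) := by linarith
      have hfJ : (fold N (m μ : ℕ) : ℝ) ≤ J := by exact_mod_cast hJge μ
      have h1 : (J : ℝ) ^ (-(2 / (d : ℝ))) ≤ (fold N (m μ : ℕ) : ℝ) ^ (-(2 / (d : ℝ))) :=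
        Real.rpow_le_rpow_of_nonpos hfpos hfJ (by
          have : 0 ≤ 2 / (d : ℝ) := by positivity
          linarith)
      have e : (fold N (m μ : ℕ) : ℝ) ^ (-sExp d)
          = ((fold N (m μ : ℕ) : ℝ))⁻¹ * (fold N (m μ : ℕ) : ℝ) ^ (-(2 / (d : ℝ))) := by
        unfold sExp
        rw [show -(1 + 2 / (d : ℝ)) = (-1) + (-(2 / (d : ℝ))) by ring, Real.rpow_add hfpos,
          Real.rpow_neg_one]
      rw [e]
      exact mul_le_mul_of_nonneg_left h1 (by positivity)
  -- assemble
  calc y / DeltaXir N m2 (shiftr N m s)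
      ≤ (∏ μ, hfac N (m μ : ℕ)) / (4 * (J : ℝ) ^ 2) := by
        rw [div_le_div_iff₀ hden_pos (by positivity)]
        exact mul_le_mul hnum hden (by positivity) hprod0
    _ = (1 / 4) * ((∏ μ, hfac N (m μ : ℕ)) * ((J : ℝ) ^ (2 : ℕ))⁻¹) := by
        field_simp
    _ ≤ (1 / 4) * ∏ μ, gfac N (sExp d) (m μ : ℕ) := by
        exact mul_le_mul_of_nonneg_left hsplit (by norm_num)

/-- **The box sum factorises**: `Σ_{m ≠ 0} Π_μ gfac(m_μ) = (Σ_j gfac j)^d − 1`. [folklore] -/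
theorem sum_erase_prod_gfac (N : ℕ) [NeZero N] (s : ℝ) :
    ∑ m ∈ (Finset.univ : Finset (Fin d → Fin N)).erase (fun _ => 0), ∏ μ, gfac N s (m μ : ℕ)
      = (∑ j : Fin N, gfac N s (j : ℕ)) ^ d - 1 := by
  rw [Finset.sum_erase_eq_sub (Finset.mem_univ _)]
  congr 1
  · rw [← Fintype.piFinset_univ, ← Finset.prod_univ_sum (fun _ : Fin d => (Finset.univ : Finset (Fin N)))
      (fun _ j => gfac N s (j : ℕ)), Finset.prod_const, Finset.card_univ, Fintype.card_fin]
  · simp [gfac]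

/-- **One coordinate is summable, uniformly in `N`**: `Σ_{j<N} gfac j ≤ 1 + 2·s/(s−1)` for `s > 1` (each folded value
`m̂ ≥ 1` is taken by at most the two indices `m̂`, `N − m̂`; then the integral test `Σ_{n≥1} n^{−s} ≤ s/(s−1)`,
tree `King1986.sum_range_rpow_neg_le`). [folklore] -/
theorem sum_gfac_le {N : ℕ} (hN : 1 ≤ N) {s : ℝ} (hs : 1 < s) :
    ∑ j : Fin N, gfac N s (j : ℕ) ≤ 1 + 2 * (s / (s - 1)) := by
  obtain ⟨K, rfl⟩ : ∃ K, N = K + 1 := ⟨N - 1, by omega⟩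
  rw [Fin.sum_univ_eq_sum_range (fun j => gfac (K + 1) s j) (K + 1), Finset.sum_range_succ']
  have h0 : gfac (K + 1) s 0 = 1 := by simp [gfac]
  rw [h0]
  -- bound each folded term by the sum of the two unfolded ones
  have hterm : ∀ i ∈ Finset.range K, gfac (K + 1) s (i + 1)
      ≤ ((i : ℝ) + 1) ^ (-s) + (((K - 1 - i : ℕ) : ℝ) + 1) ^ (-s) := by
    intro i hi
    have hiK : i < K := Finset.mem_range.mp hi
    have ha : 0 ≤ ((i : ℝ) + 1) ^ (-s) := rpow_nonneg (by positivity) _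
    have hb : 0 ≤ (((K - 1 - i : ℕ) : ℝ) + 1) ^ (-s) := rpow_nonneg (by positivity) _
    unfold gfac
    rw [if_neg (Nat.succ_ne_zero i)]
    unfold fold
    rcases min_choice (i + 1) (K + 1 - (i + 1)) with h | h
    · rw [h]; push_cast; linarith
    · rw [h]
      have e : ((K + 1 - (i + 1) : ℕ) : ℝ) = ((K - 1 - i : ℕ) : ℝ) + 1 := by
        have : K + 1 - (i + 1) = (K - 1 - i) + 1 := by omega
        rw [this]; push_cast; ring
      rw [e]; linarith
  have h1 := sum_range_rpow_neg_le hs K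
  have h2 : ∑ i ∈ Finset.range K, (((K - 1 - i : ℕ) : ℝ) + 1) ^ (-s) ≤ s / (s - 1) := by
    rw [Finset.sum_range_reflect (fun i => ((i : ℝ) + 1) ^ (-s)) K]
    exact h1
  calc ∑ i ∈ Finset.range K, gfac (K + 1) s (i + 1) + 1
      ≤ ∑ i ∈ Finset.range K, (((i : ℝ) + 1) ^ (-s) + (((K - 1 - i : ℕ) : ℝ) + 1) ^ (-s)) + 1 := by
        gcongr with i hi; exact hterm i hi
    _ = (∑ i ∈ Finset.range K, ((i : ℝ) + 1) ^ (-s))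
          + (∑ i ∈ Finset.range K, (((K - 1 - i : ℕ) : ℝ) + 1) ^ (-s)) + 1 := by
        rw [Finset.sum_add_distrib]
    _ ≤ s / (s - 1) + s / (s - 1) + 1 := by gcongr
    _ = 1 + 2 * (s / (s - 1)) := by ring

/-- the alias constant `C_Y(d) = ((d+3)^d − 1)/4` (`= 600` for `d = 4`). [folklore] -/
def aliasC (d : ℕ) : ℝ := (((d : ℝ) + 3) ^ d - 1) / 4

/-- `C_Y(4) = 600`. [folklore] -/
theorem aliasC_four : aliasC 4 = 600 := by norm_num [aliasC]

/-- `C_Y(d) ≥ 0`. [folklore] -/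
theorem aliasC_nonneg (d : ℕ) : 0 ≤ aliasC d := by
  unfold aliasC
  have : (1 : ℝ) ≤ ((d : ℝ) + 3) ^ d := one_le_pow₀ (by linarith [(Nat.cast_nonneg d : (0 : ℝ) ≤ d)])
  linarith

/-- **THE OFF-CENTRE ALIAS SUM** (King (4.22) in folded form, `α = −1`): for `d ≥ 1`, `N ≥ 1`, `m² ≥ 0` and
`|p′_μ| ≤ π`, with `y_m ≥ 0`, `y_m² = |u(p′+2πm)|²`:
`Σ_{m ≠ 0} y_m / (Δ(p′+2πm) + m²) ≤ C_Y(d) = ((d+3)^d − 1)/4`, uniformly in `N` and `p′`.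
[cite: King1986, (4.22) p.672] -/
theorem offCentre_sum_le (hd : 0 < d) {N : ℕ} [NeZero N] (hN : 1 ≤ N) {m2 : ℝ} (hm2 : 0 ≤ m2)
    {s : Fin d → ℝ} (hs : ∀ μ, |s μ| ≤ π) (y : (Fin d → Fin N) → ℝ) (hy0 : ∀ m, 0 ≤ y m)
    (hy : ∀ m, y m ^ 2 = Ur N m s) :
    ∑ m ∈ (Finset.univ : Finset (Fin d → Fin N)).erase (fun _ => 0), y m / DeltaXir N m2 (shiftr N m s)
      ≤ aliasC d := by
  have hdR : (0 : ℝ) < d := by exact_mod_cast hd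
  have hsE : 1 < sExp d := by
    unfold sExp
    have h2 : (0 : ℝ) < 2 / (d : ℝ) := by positivity
    linarith
  calc ∑ m ∈ (Finset.univ : Finset (Fin d → Fin N)).erase (fun _ => 0), y m / DeltaXir N m2 (shiftr N m s)
      ≤ ∑ m ∈ (Finset.univ : Finset (Fin d → Fin N)).erase (fun _ => 0),
          (1 / 4) * ∏ μ, gfac N (sExp d) (m μ : ℕ) := by
        refine Finset.sum_le_sum fun m hm => ?_
        exact sqrtUr_div_le_prod_gfac hd hN m (Finset.ne_of_mem_erase hm) hm2 hs (hy0 m) (hy m)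
    _ = (1 / 4) * ((∑ j : Fin N, gfac N (sExp d) (j : ℕ)) ^ d - 1) := by
        rw [← Finset.mul_sum, sum_erase_prod_gfac]
    _ ≤ (1 / 4) * (((d : ℝ) + 3) ^ d - 1) := by
        have hS0 : 0 ≤ ∑ j : Fin N, gfac N (sExp d) (j : ℕ) := Finset.sum_nonneg fun j _ => gfac_nonneg N _ _
        have hS := sum_gfac_le hN hsE
        have e : 1 + 2 * (sExp d / (sExp d - 1)) = (d : ℝ) + 3 := by
          unfold sExp; field_simp; ring
        rw [e] at hS
        have := pow_le_pow_left₀ hS0 hS d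
        linarith
    _ = aliasC d := by unfold aliasC; ring


/-! ## §2b The same with `√σ` in the denominator (for DIFFERENCED kernels): exponent `s = 1 + 1/d` -/

/-- the exponent `s = 1 + 1/d` for the half-power denominators. [folklore] -/
def sExp2 (d : ℕ) : ℝ := 1 + 1 / (d : ℝ)

/-- **Termwise majorant, half power.**  For `m ≠ 0`: `√(|u(p′+2πm)|²)/√(Δ(p′+2πm)+m²) ≤ ½ Π_μ gfac_{1+1/d}(m_μ)`
(`√Δ ≥ 2 m̂_max`, `m̂_max^{−1} = Π_μ m̂_max^{−1/d}`). [cite: King1986, (4.20)–(4.22) p.672] -/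
theorem sqrtUr_div_sqrt_le_prod_gfac (hd : 0 < d) {N : ℕ} [NeZero N] (hN : 1 ≤ N) (m : Fin d → Fin N)
    (hm : m ≠ fun _ => 0) {m2 : ℝ} (hm2 : 0 ≤ m2) {s : Fin d → ℝ} (hs : ∀ μ, |s μ| ≤ π) {y : ℝ} (hy0 : 0 ≤ y)
    (hy : y ^ 2 = Ur N m s) :
    y / Real.sqrt (DeltaXir N m2 (shiftr N m s)) ≤ (1 / 2) * ∏ μ, gfac N (sExp2 d) (m μ : ℕ) := by
  have hdR : (0 : ℝ) < d := by exact_mod_cast hd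
  obtain ⟨ν, -, hν⟩ := Finset.exists_mem_eq_sup (Finset.univ : Finset (Fin d))
    (Finset.univ_nonempty_iff.mpr ⟨⟨0, hd⟩⟩) (fun μ => fold N (m μ : ℕ))
  set J : ℕ := Finset.univ.sup (fun μ => fold N (m μ : ℕ)) with hJdef
  have hJge : ∀ μ, fold N (m μ : ℕ) ≤ J := fun μ =>
    Finset.le_sup (f := fun μ => fold N (m μ : ℕ)) (Finset.mem_univ μ)
  obtain ⟨μ₀, hμ₀⟩ : ∃ μ, (m μ : ℕ) ≠ 0 := by
    by_contra hcon
    push Not at hcon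
    exact hm (funext fun μ => Fin.ext (by simpa using hcon μ))
  have hJ1 : 1 ≤ J := le_trans (one_le_fold (Nat.one_le_iff_ne_zero.mpr hμ₀) (m μ₀).isLt) (hJge μ₀)
  have hν0 : (m ν : ℕ) ≠ 0 := by
    intro h0
    rw [h0, fold_zero] at hν
    omega
  have hJR : (1 : ℝ) ≤ J := by exact_mod_cast hJ1
  have hJpos : (0 : ℝ) < J := by linarith
  -- √denominator ≥ 2J
  have hden : 4 * (J : ℝ) ^ 2 ≤ DeltaXir N m2 (shiftr N m s) := by
    have := four_mul_fold_sq_le_DeltaXir m hm2 hs ν hν0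
    rwa [← hν] at this
  have hsq : 2 * (J : ℝ) ≤ Real.sqrt (DeltaXir N m2 (shiftr N m s)) := by
    rw [show (2 * (J : ℝ)) = Real.sqrt ((2 * (J : ℝ)) ^ 2) from (Real.sqrt_sq (by positivity)).symm]
    exact Real.sqrt_le_sqrt (by nlinarith)
  have hsq_pos : 0 < Real.sqrt (DeltaXir N m2 (shiftr N m s)) := lt_of_lt_of_le (by positivity) hsq
  -- numerator ≤ Π hfac
  have hprod0 : 0 ≤ ∏ μ, hfac N (m μ : ℕ) := Finset.prod_nonneg fun μ _ => hfac_nonneg N _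
  have hnum : y ≤ ∏ μ, hfac N (m μ : ℕ) := by
    have h := Ur_le_prod_hfac_sq hN m hs
    rw [← hy, Finset.prod_pow] at h
    exact (pow_le_pow_iff_left₀ hy0 hprod0 two_ne_zero).mp h
  -- (Π hfac) · J^{−1} ≤ Π gfac
  have hsplit : (∏ μ, hfac N (m μ : ℕ)) * ((J : ℝ))⁻¹ ≤ ∏ μ, gfac N (sExp2 d) (m μ : ℕ) := by
    have hJpow : ((J : ℝ))⁻¹ = ∏ _μ : Fin d, (J : ℝ) ^ (-(1 / (d : ℝ))) := by
      rw [Finset.prod_const, Finset.card_univ, Fintype.card_fin,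
        ← Real.rpow_natCast ((J : ℝ) ^ (-(1 / (d : ℝ)))) d, ← Real.rpow_mul hJpos.le]
      have e : -(1 / (d : ℝ)) * ((d : ℕ) : ℝ) = -(1 : ℝ) := by
        field_simp
      rw [e, Real.rpow_neg_one]
    rw [hJpow, ← Finset.prod_mul_distrib]
    refine Finset.prod_le_prod (fun μ _ => mul_nonneg (hfac_nonneg N _) (rpow_nonneg hJpos.le _)) fun μ _ => ?_
    have hJd1 : (J : ℝ) ^ (-(1 / (d : ℝ))) ≤ 1 :=
      Real.rpow_le_one_of_one_le_of_nonpos hJR (by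
        have : 0 ≤ 1 / (d : ℝ) := by positivity
        linarith)
    unfold hfac gfac
    by_cases h0 : (m μ : ℕ) = 0
    · rw [if_pos h0, if_pos h0, one_mul]; exact hJd1
    · rw [if_neg h0, if_neg h0]
      have hf1 : (1 : ℝ) ≤ fold N (m μ : ℕ) := by
        exact_mod_cast one_le_fold (Nat.one_le_iff_ne_zero.mpr h0) (m μ).isLt
      have hfpos : (0 : ℝ) < fold N (m μ : ℕ) := by linarith
      have hfJ : (fold N (m μ : ℕ) : ℝ) ≤ J := by exact_mod_cast hJge μ
      have h1 : (J : ℝ) ^ (-(1 / (d : ℝ))) ≤ (fold N (m μ : ℕ) : ℝ) ^ (-(1 / (d : ℝ))) :=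
        Real.rpow_le_rpow_of_nonpos hfpos hfJ (by
          have : 0 ≤ 1 / (d : ℝ) := by positivity
          linarith)
      have e : (fold N (m μ : ℕ) : ℝ) ^ (-sExp2 d)
          = ((fold N (m μ : ℕ) : ℝ))⁻¹ * (fold N (m μ : ℕ) : ℝ) ^ (-(1 / (d : ℝ))) := by
        unfold sExp2
        rw [show -(1 + 1 / (d : ℝ)) = (-1) + (-(1 / (d : ℝ))) by ring, Real.rpow_add hfpos,
          Real.rpow_neg_one]
      rw [e]
      exact mul_le_mul_of_nonneg_left h1 (by positivity)
  calc y / Real.sqrt (DeltaXir N m2 (shiftr N m s))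
      ≤ (∏ μ, hfac N (m μ : ℕ)) / (2 * (J : ℝ)) := by
        rw [div_le_div_iff₀ hsq_pos (by positivity)]
        exact mul_le_mul hnum hsq (by positivity) hprod0
    _ = (1 / 2) * ((∏ μ, hfac N (m μ : ℕ)) * ((J : ℝ))⁻¹) := by
        field_simp
    _ ≤ (1 / 2) * ∏ μ, gfac N (sExp2 d) (m μ : ℕ) := by
        exact mul_le_mul_of_nonneg_left hsplit (by norm_num)

/-- the half-power alias constant `C′_Y(d) = ((2d+3)^d − 1)/2` (`= 7320` for `d = 4`). [folklore] -/
def aliasC2 (d : ℕ) : ℝ := ((2 * (d : ℝ) + 3) ^ d - 1) / 2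

/-- `C′_Y(4) = 7320`. [folklore] -/
theorem aliasC2_four : aliasC2 4 = 7320 := by norm_num [aliasC2]

/-- `C′_Y(d) ≥ 0`. [folklore] -/
theorem aliasC2_nonneg (d : ℕ) : 0 ≤ aliasC2 d := by
  unfold aliasC2
  have : (1 : ℝ) ≤ (2 * (d : ℝ) + 3) ^ d := one_le_pow₀ (by linarith [(Nat.cast_nonneg d : (0 : ℝ) ≤ d)])
  linarith

/-- **THE OFF-CENTRE ALIAS SUM, HALF POWER**: `Σ_{m ≠ 0} y_m/√(Δ(p′+2πm)+m²) ≤ C′_Y(d)`, uniformly in `N`, `p′`.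
[cite: King1986, (4.22) p.672] -/
theorem offCentre_sqrt_sum_le (hd : 0 < d) {N : ℕ} [NeZero N] (hN : 1 ≤ N) {m2 : ℝ} (hm2 : 0 ≤ m2)
    {s : Fin d → ℝ} (hs : ∀ μ, |s μ| ≤ π) (y : (Fin d → Fin N) → ℝ) (hy0 : ∀ m, 0 ≤ y m)
    (hy : ∀ m, y m ^ 2 = Ur N m s) :
    ∑ m ∈ (Finset.univ : Finset (Fin d → Fin N)).erase (fun _ => 0),
        y m / Real.sqrt (DeltaXir N m2 (shiftr N m s)) ≤ aliasC2 d := by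
  have hdR : (0 : ℝ) < d := by exact_mod_cast hd
  have hsE : 1 < sExp2 d := by
    unfold sExp2
    have h2 : (0 : ℝ) < 1 / (d : ℝ) := by positivity
    linarith
  calc ∑ m ∈ (Finset.univ : Finset (Fin d → Fin N)).erase (fun _ => 0),
          y m / Real.sqrt (DeltaXir N m2 (shiftr N m s))
      ≤ ∑ m ∈ (Finset.univ : Finset (Fin d → Fin N)).erase (fun _ => 0),
          (1 / 2) * ∏ μ, gfac N (sExp2 d) (m μ : ℕ) := by
        refine Finset.sum_le_sum fun m hm => ?_
        exact sqrtUr_div_sqrt_le_prod_gfac hd hN m (Finset.ne_of_mem_erase hm) hm2 hs (hy0 m) (hy m)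
    _ = (1 / 2) * ((∑ j : Fin N, gfac N (sExp2 d) (j : ℕ)) ^ d - 1) := by
        rw [← Finset.mul_sum, sum_erase_prod_gfac]
    _ ≤ (1 / 2) * ((2 * (d : ℝ) + 3) ^ d - 1) := by
        have hS0 : 0 ≤ ∑ j : Fin N, gfac N (sExp2 d) (j : ℕ) := Finset.sum_nonneg fun j _ => gfac_nonneg N _ _
        have hS := sum_gfac_le hN hsE
        have e : 1 + 2 * (sExp2 d / (sExp2 d - 1)) = 2 * (d : ℝ) + 3 := by
          unfold sExp2; field_simp; ring
        rw [e] at hS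
        have := pow_le_pow_left₀ hS0 hS d
        linarith
    _ = aliasC2 d := by unfold aliasC2; ring

/-! ## §3 The fibre amplitude `A_q(x)` and the per-fibre bound (any `d ≥ 1`, any periods) -/

section Fibre

variable (N : ℕ) [NeZero N] (M : Fin d → ℕ) [hM : ∀ μ, NeZero (M μ)]

/-- `|e^{ip·x}| = 1`. [folklore] -/
theorem norm_chi (K : Fin d → ℕ) [∀ μ, NeZero (K μ)] (p x : Tor K) : ‖chi K p x‖ = 1 := by
  unfold chi
  rw [norm_prod]
  refine Finset.prod_eq_one fun μ _ => ?_
  rw [ZMod.stdAddChar_apply]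
  exact Circle.norm_coe _

/-- `σ(p) = m² + c·Σ_μ(2 − 2cos p_μ) ≥ 0` for `c, m² ≥ 0`. [folklore] -/
theorem lapSym_nonneg (K : Fin d → ℕ) [∀ μ, NeZero (K μ)] {c m2 : ℝ} (hc : 0 ≤ c) (hm2 : 0 ≤ m2) (p : Tor K) :
    0 ≤ lapSym K c m2 p := by
  unfold lapSym
  have : 0 ≤ ∑ μ : Fin d, (2 - 2 * Real.cos (sOf K p μ)) :=
    Finset.sum_nonneg fun μ _ => by linarith [Real.cos_le_one (sOf K p μ)]
  positivity

/-- THE FIBRE AMPLITUDE `A_q(x) = Σ_{p ∈ fib q} e^{−ip·x} u(p)/σ(p)` (King scaling `c = N²`): the `x`-dependence of the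
rank-one (Woodbury) part of the fluctuation propagator on the fibre over the coarse momentum `q`. [folklore] -/
def famp (m2 : ℝ) (q : Tor M) (x : Tor (fine N M)) : ℂ :=
  ∑ p ∈ fib N M q, conj (chi (fine N M) p x) * (u N M p / (lapSym (fine N M) ((N : ℝ) ^ 2) m2 p : ℂ))

/-- THE OFF-CENTRE ALIAS MASS of the fibre: `Y(q) = Σ_{m ≠ 0} |u(p′+2πm)|/σ(p′+2πm)`. [folklore] -/
def Yoff (m2 : ℝ) (q : Tor M) : ℝ :=
  ∑ m ∈ (Finset.univ : Finset (Fin d → Fin N)).erase (fun _ => 0),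
    ‖u N M (pOf N M (m, q))‖ / lapSym (fine N M) ((N : ℝ) ^ 2) m2 (pOf N M (m, q))

/-- THE WOODBURY (rank-one-per-fibre) CORRECTION KERNEL, punctured at the zero fibre:
`R⊥(x,x′) = |𝕋|⁻¹ Σ_{q ≠ 0} κ(q) A_q(x) conj(A_q(x′))`. [folklore] -/
def Rperp (a m2 : ℝ) (x x' : Tor (fine N M)) : ℂ :=
  ((Fintype.card (Tor (fine N M)) : ℂ))⁻¹ *
    ∑ q ∈ (Finset.univ : Finset (Tor M)).erase 0,
      (kap N M a ((N : ℝ) ^ 2) m2 q : ℂ) * famp N M m2 q x * conj (famp N M m2 q x')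

omit hM in
/-- the central alias of the fibre is `pOf (0, q) = z q`. [folklore] -/
theorem pOf_zero_eq_z (q : Tor M) : pOf N M ((fun _ => (0 : Fin N)), q) = z N M q := by
  funext μ
  simp [B5Block118.pOf, z]

/-- `σ(z q) = Δ_ξ(p′) + m²` with `p′ = sOf q`. [folklore] -/
theorem lapSym_z (m2 : ℝ) (q : Tor M) :
    lapSym (fine N M) ((N : ℝ) ^ 2) m2 (z N M q) = DeltaXir N m2 (sOf M q) := by
  rw [← pOf_zero_eq_z N M q, lapSym_pOf, B5Prop11Leaves.shiftr_zero]

/-- `σ(z q) > 0` for `q ≠ 0` (`N ≥ 1`, `m² ≥ 0`). [folklore] -/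
theorem lapSym_z_pos (hN : 1 ≤ N) {m2 : ℝ} (hm2 : 0 ≤ m2) {q : Tor M} (hq : q ≠ 0) :
    0 < lapSym (fine N M) ((N : ℝ) ^ 2) m2 (z N M q) := by
  rw [lapSym_z]
  obtain ⟨μ, hμ⟩ := Function.ne_iff.mp (B5Prop11Plancherel.sOf_ne_zero M hq)
  have h := DeltaXir_pos N hN (sOf M q) (abs_sOf_le M q) μ hμ
  have e : DeltaXir N m2 (sOf M q) = DeltaXir N 0 (sOf M q) + m2 := by unfold DeltaXir; ring
  rw [e]; linarith

/-- `σ(z q) ≤ dπ² + m²`. [folklore] -/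
theorem lapSym_z_le {m2 : ℝ} (q : Tor M) :
    lapSym (fine N M) ((N : ℝ) ^ 2) m2 (z N M q) ≤ d * π ^ 2 + m2 := by
  rw [lapSym_z]
  unfold DeltaXir
  have h : ∀ μ, Sxir N (sOf M q μ) ≤ π ^ 2 := fun μ => by
    have h1 := Sxir_le N (sOf M q μ)
    have h2 : sOf M q μ ^ 2 ≤ π ^ 2 := by
      rw [← sq_abs]; exact pow_le_pow_left₀ (abs_nonneg _) (abs_sOf_le M q μ) 2
    linarith
  have := Finset.sum_le_sum fun μ (_ : μ ∈ Finset.univ) => h μ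
  rw [Finset.sum_const, Finset.card_univ, Fintype.card_fin, nsmul_eq_mul] at this
  linarith

/-- the alias mass is bounded by the §2 constant: `Y(q) ≤ C_Y(d)`. [cite: King1986, (4.22) p.672] -/
theorem Yoff_le (hd : 0 < d) (hN : 1 ≤ N) {m2 : ℝ} (hm2 : 0 ≤ m2) (q : Tor M) : Yoff N M m2 q ≤ aliasC d := by
  unfold Yoff
  simp_rw [lapSym_pOf]
  exact offCentre_sum_le hd hN hm2 (abs_sOf_le M q) (fun m => ‖u N M (pOf N M (m, q))‖) (fun m => norm_nonneg _)
    (fun m => norm_sq_u_pOf N M hN m q)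

/-- **(B1)** `|A_q(x)| ≤ |u(z q)|/σ(z q) + Y(q)` (triangle inequality, `|e^{−ip·x}| = 1`, split off the central alias).
[folklore] -/
theorem norm_famp_le (hN : 1 ≤ N) {m2 : ℝ} (hm2 : 0 ≤ m2) (q : Tor M) (x : Tor (fine N M)) :
    ‖famp N M m2 q x‖ ≤ ‖u N M (z N M q)‖ / lapSym (fine N M) ((N : ℝ) ^ 2) m2 (z N M q) + Yoff N M m2 q := by
  have hσ0 : ∀ p, 0 ≤ lapSym (fine N M) ((N : ℝ) ^ 2) m2 p := fun p => lapSym_nonneg _ (by positivity) hm2 p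
  unfold famp Yoff
  calc ‖∑ p ∈ fib N M q, conj (chi (fine N M) p x) * (u N M p / (lapSym (fine N M) ((N : ℝ) ^ 2) m2 p : ℂ))‖
      ≤ ∑ p ∈ fib N M q, ‖conj (chi (fine N M) p x) * (u N M p / (lapSym (fine N M) ((N : ℝ) ^ 2) m2 p : ℂ))‖ :=
        norm_sum_le _ _
    _ = ∑ p ∈ fib N M q, ‖u N M p‖ / lapSym (fine N M) ((N : ℝ) ^ 2) m2 p := by
        refine Finset.sum_congr rfl fun p _ => ?_
        rw [norm_mul, Complex.norm_conj, norm_chi, one_mul, norm_div, Complex.norm_real, Real.norm_eq_abs,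
          abs_of_nonneg (hσ0 p)]
    _ = ∑ m : Fin d → Fin N, ‖u N M (pOf N M (m, q))‖ / lapSym (fine N M) ((N : ℝ) ^ 2) m2 (pOf N M (m, q)) :=
        sum_fib_eq_sum_pOf N M q _
    _ = _ := by
        rw [← Finset.add_sum_erase _ _ (Finset.mem_univ (fun _ => (0 : Fin N))), pOf_zero_eq_z]

/-- **(B3)** `|u(z q)|²/σ(z q) ≤ S(q)` (one term of the fibre sum). [folklore] -/
theorem central_le_Sfib {m2 : ℝ} (hm2 : 0 ≤ m2) (q : Tor M) :
    ‖u N M (z N M q)‖ ^ 2 / lapSym (fine N M) ((N : ℝ) ^ 2) m2 (z N M q) ≤ Sfib N M ((N : ℝ) ^ 2) m2 q := by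
  unfold Sfib
  exact Finset.single_le_sum (f := fun p => ‖u N M p‖ ^ 2 / lapSym (fine N M) ((N : ℝ) ^ 2) m2 p)
    (fun p _ => div_nonneg (sq_nonneg _) (lapSym_nonneg _ (by positivity) hm2 p)) (z_mem_fib N M q)

/-- **(B3′)** `κ(q) = a/(1 + aS(q)) ≤ σ(z q)/|u(z q)|²` for `a > 0`, `q ≠ 0`. [folklore] -/
theorem kap_le (hN : 1 ≤ N) {a m2 : ℝ} (ha : 0 < a) (hm2 : 0 ≤ m2) {q : Tor M} (hq : q ≠ 0) :
    kap N M a ((N : ℝ) ^ 2) m2 q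
      ≤ lapSym (fine N M) ((N : ℝ) ^ 2) m2 (z N M q) / ‖u N M (z N M q)‖ ^ 2 := by
  have hσ := lapSym_z_pos N M hN hm2 hq
  have hu : 0 < ‖u N M (z N M q)‖ ^ 2 := lt_of_lt_of_le (by positivity) (norm_sq_u_central N M hN q)
  have hS := central_le_Sfib N M hm2 q
  have hS0 : 0 < Sfib N M ((N : ℝ) ^ 2) m2 q := lt_of_lt_of_le (div_pos hu hσ) hS
  unfold kap
  calc a / (1 + a * Sfib N M ((N : ℝ) ^ 2) m2 q) ≤ 1 / Sfib N M ((N : ℝ) ^ 2) m2 q := by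
        rw [div_le_div_iff₀ (by positivity) hS0]; nlinarith
    _ ≤ 1 / (‖u N M (z N M q)‖ ^ 2 / lapSym (fine N M) ((N : ℝ) ^ 2) m2 (z N M q)) :=
        one_div_le_one_div_of_le (div_pos hu hσ) hS
    _ = _ := by rw [one_div_div]

/-- `κ(q) ≥ 0` for `a ≥ 0`, `m2 ≥ 0`. [folklore] -/
theorem kap_nonneg' {a m2 : ℝ} (ha : 0 ≤ a) (hm2 : 0 ≤ m2) (q : Tor M) : 0 ≤ kap N M a ((N : ℝ) ^ 2) m2 q := by
  unfold kap
  have : 0 ≤ Sfib N M ((N : ℝ) ^ 2) m2 q := by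
    unfold Sfib
    exact Finset.sum_nonneg fun p _ => div_nonneg (sq_nonneg _) (lapSym_nonneg _ (by positivity) hm2 p)
  positivity

/-- **(B4) THE PER-FIBRE BOUND.**  For `q ≠ 0`, `a > 0`, `m² ≥ 0`, `N ≥ 1`, `d ≥ 1` and all `x, x′`:
`‖κ(q) A_q(x) conj A_q(x′)‖ ≤ 2/σ(z q) + 2·C_Y(d)²·(π²/4)^d·(dπ² + m²)` — the central alias contributes the FREE
fibre propagator `1/σ(z q)` (twice), the off-centre aliases an `O(1)` uniformly in `N` (King's "no small denominators",
p. 672). [cite: King1986, (4.20)–(4.22) p.672] -/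
theorem fibre_term_le (hd : 0 < d) (hN : 1 ≤ N) {a m2 : ℝ} (ha : 0 < a) (hm2 : 0 ≤ m2) {q : Tor M} (hq : q ≠ 0)
    (x x' : Tor (fine N M)) :
    ‖(kap N M a ((N : ℝ) ^ 2) m2 q : ℂ) * famp N M m2 q x * conj (famp N M m2 q x')‖
      ≤ 2 / lapSym (fine N M) ((N : ℝ) ^ 2) m2 (z N M q)
        + 2 * aliasC d ^ 2 * ((π ^ 2 / 4) ^ d * (d * π ^ 2 + m2)) := by
  set σ₀ := lapSym (fine N M) ((N : ℝ) ^ 2) m2 (z N M q) with hσ₀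
  set u₀ := ‖u N M (z N M q)‖ with hu₀
  set κ := kap N M a ((N : ℝ) ^ 2) m2 q with hκ
  set Y := Yoff N M m2 q with hY
  have hσ := lapSym_z_pos N M hN hm2 hq
  have hu2 : (4 / π ^ 2) ^ d ≤ u₀ ^ 2 := norm_sq_u_central N M hN q
  have hu : 0 < u₀ ^ 2 := lt_of_lt_of_le (by positivity) hu2
  have hκ0 : 0 ≤ κ := kap_nonneg' N M ha.le hm2 q
  have hκle : κ ≤ σ₀ / u₀ ^ 2 := kap_le N M hN ha hm2 hq
  have hY0 : 0 ≤ Y := by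
    rw [hY]; unfold Yoff
    exact Finset.sum_nonneg fun m _ => div_nonneg (norm_nonneg _) (lapSym_nonneg _ (by positivity) hm2 _)
  have hYC : Y ≤ aliasC d := Yoff_le N M hd hN hm2 q
  have hA := norm_famp_le N M hN hm2 q x
  have hA' := norm_famp_le N M hN hm2 q x'
  have hB0 : 0 ≤ u₀ / σ₀ + Y := by positivity
  -- the norm of the product
  have h1 : ‖(κ : ℂ) * famp N M m2 q x * conj (famp N M m2 q x')‖ ≤ κ * ((u₀ / σ₀ + Y) * (u₀ / σ₀ + Y)) := by
    rw [norm_mul, norm_mul, Complex.norm_conj, Complex.norm_real, Real.norm_eq_abs, abs_of_nonneg hκ0, mul_assoc]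
    exact mul_le_mul_of_nonneg_left (mul_le_mul hA hA' (norm_nonneg _) hB0) hκ0
  -- `κ (A+Y)² ≤ 2κA² + 2κY²`, `κA² ≤ 1/σ₀`, `κ ≤ σ₀/u₀² ≤ (π²/4)^d (dπ²+m²)`
  have h2 : (u₀ / σ₀ + Y) * (u₀ / σ₀ + Y) ≤ 2 * (u₀ / σ₀) ^ 2 + 2 * Y ^ 2 := by
    nlinarith [sq_nonneg (u₀ / σ₀ - Y)]
  have hu0 : u₀ ≠ 0 := by
    intro h0; rw [h0] at hu; simp at hu
  have h3 : κ * (u₀ / σ₀) ^ 2 ≤ 1 / σ₀ := by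
    calc κ * (u₀ / σ₀) ^ 2 ≤ σ₀ / u₀ ^ 2 * (u₀ / σ₀) ^ 2 := mul_le_mul_of_nonneg_right hκle (sq_nonneg _)
      _ = 1 / σ₀ := by field_simp
  have h4 : σ₀ / u₀ ^ 2 ≤ (π ^ 2 / 4) ^ d * (d * π ^ 2 + m2) := by
    have hle := lapSym_z_le N M (m2 := m2) q
    rw [div_le_iff₀ hu]
    calc σ₀ ≤ d * π ^ 2 + m2 := hle
      _ = (π ^ 2 / 4) ^ d * (d * π ^ 2 + m2) * (4 / π ^ 2) ^ d := by
          rw [mul_comm ((π ^ 2 / 4) ^ d), mul_assoc, ← mul_pow]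
          have : π ^ 2 / 4 * (4 / π ^ 2) = 1 := by field_simp
          rw [this, one_pow, mul_one]
      _ ≤ (π ^ 2 / 4) ^ d * (d * π ^ 2 + m2) * u₀ ^ 2 := by
          have : 0 ≤ (π ^ 2 / 4) ^ d * (d * π ^ 2 + m2) := by positivity
          exact mul_le_mul_of_nonneg_left hu2 this
  have h5 : κ * Y ^ 2 ≤ aliasC d ^ 2 * ((π ^ 2 / 4) ^ d * (d * π ^ 2 + m2)) := by
    have hY2 : Y ^ 2 ≤ aliasC d ^ 2 := pow_le_pow_left₀ hY0 hYC 2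
    calc κ * Y ^ 2 ≤ (σ₀ / u₀ ^ 2) * aliasC d ^ 2 := mul_le_mul hκle hY2 (sq_nonneg _) (by positivity)
      _ ≤ ((π ^ 2 / 4) ^ d * (d * π ^ 2 + m2)) * aliasC d ^ 2 :=
          mul_le_mul_of_nonneg_right h4 (sq_nonneg _)
      _ = _ := by ring
  calc ‖(κ : ℂ) * famp N M m2 q x * conj (famp N M m2 q x')‖
      ≤ κ * ((u₀ / σ₀ + Y) * (u₀ / σ₀ + Y)) := h1
    _ ≤ κ * (2 * (u₀ / σ₀) ^ 2 + 2 * Y ^ 2) := mul_le_mul_of_nonneg_left h2 hκ0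
    _ = 2 * (κ * (u₀ / σ₀) ^ 2) + 2 * (κ * Y ^ 2) := by ring
    _ ≤ 2 * (1 / σ₀) + 2 * (aliasC d ^ 2 * ((π ^ 2 / 4) ^ d * (d * π ^ 2 + m2))) := by gcongr
    _ = _ := by ring

end Fibre

/-! ## §4 `d = 4`, equal periods: the volume-uniform `O(N⁻⁴)` bound on the punctured Woodbury kernel -/

section Four

open Literature.Probability.LatticeModels (annulus)
open DyadicShell (Pt supNorm mem_annulus_iff supNorm_le_iff supNorm_eq_zero_iff natAbs_le_supNorm exists_eq_supNorm)
open Literature.MathematicalPhysics.QuantumFieldTheory.King1986 (momSq DeltaXir_ge_momSq)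

variable (N M₀ : ℕ) [NeZero N] [NeZero M₀]

/-- equal coarse periods `M_μ = M₀`. [folklore] -/
abbrev cM (M₀ : ℕ) : Fin 4 → ℕ := fun _ => M₀

/-- the centred integer representative vector of a coarse momentum. [folklore] -/
def vOf (q : Tor (cM M₀)) : Pt := fun μ => (q μ).valMinAbs

omit [NeZero M₀] in
/-- the centred representative is injective. [folklore] -/
theorem vOf_injective : Function.Injective (vOf M₀) := by
  intro q q' h
  funext μ
  have := congrFun h μ
  simpa [vOf, ZMod.valMinAbs_inj] using this

/-- `q ≠ 0 ⇒ 0 < ‖v(q)‖_∞ ≤ M₀/2`. [folklore] -/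
theorem vOf_mem_annulus {q : Tor (cM M₀)} (hq : q ≠ 0) : vOf M₀ q ∈ annulus 4 0 (M₀ / 2) := by
  rw [mem_annulus_iff]
  refine ⟨Nat.pos_of_ne_zero fun h0 => hq ?_, supNorm_le_iff.mpr fun μ => ZMod.natAbs_valMinAbs_le (q μ)⟩
  have hv : vOf M₀ q = 0 := supNorm_eq_zero_iff.mp h0
  funext μ
  have := congrFun hv μ
  simpa [vOf, ZMod.valMinAbs_eq_zero] using this

/-- **Central coercivity in shell form**: `σ(z q) ≥ 16‖v(q)‖_∞²/M₀²` for `q ≠ 0` (Jordan: `S_ξ(x) ≥ (4/π²)x²`, and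
`p′_μ = 2πv_μ/M₀`). [folklore] -/
theorem lapSym_z_ge_supNorm (hN : 1 ≤ N) {m2 : ℝ} (hm2 : 0 ≤ m2) (q : Tor (cM M₀)) :
    16 * (supNorm (vOf M₀ q) : ℝ) ^ 2 / (M₀ : ℝ) ^ 2
      ≤ lapSym (fine N (cM M₀)) ((N : ℝ) ^ 2) m2 (z N (cM M₀) q) := by
  rw [lapSym_z]
  have hM : (0 : ℝ) < M₀ := by exact_mod_cast Nat.pos_of_ne_zero (NeZero.ne M₀)
  have h1 := DeltaXir_ge_momSq hN hm2 (abs_sOf_le (cM M₀) q)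
  obtain ⟨ν, hν⟩ := exists_eq_supNorm (vOf M₀ q)
  have h2 : sOf (cM M₀) q ν ^ 2 ≤ momSq (sOf (cM M₀) q) := by
    unfold momSq
    exact Finset.single_le_sum (f := fun μ => sOf (cM M₀) q μ ^ 2) (fun μ _ => sq_nonneg _) (Finset.mem_univ ν)
  have h3 : sOf (cM M₀) q ν ^ 2 = 4 * π ^ 2 * (supNorm (vOf M₀ q) : ℝ) ^ 2 / (M₀ : ℝ) ^ 2 := by
    have e : ((supNorm (vOf M₀ q) : ℕ) : ℝ) = |(((q ν).valMinAbs : ℤ) : ℝ)| := by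
      rw [← hν, Nat.cast_natAbs (α := ℝ), Int.cast_abs]; rfl
    unfold sOf
    rw [e, sq_abs]
    simp only [cM]
    field_simp
    ring
  calc 16 * (supNorm (vOf M₀ q) : ℝ) ^ 2 / (M₀ : ℝ) ^ 2 = 4 / π ^ 2 * sOf (cM M₀) q ν ^ 2 := by
        rw [h3]; field_simp; ring
    _ ≤ 4 / π ^ 2 * momSq (sOf (cM M₀) q) := by gcongr
    _ ≤ _ := h1

/-- **The shell sum**: `Σ_{q ≠ 0} 1/σ(z q) ≤ (5/4)·M₀⁴` (the `d = 4` dyadic-shell engine `Σ_{0<‖w‖_∞≤M} ‖w‖_∞⁻² ≤ 80M²`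
of `Beta/LargeLWindow`, applied to `‖v(q)‖_∞ ≤ M₀/2`). [folklore] -/
theorem sum_inv_lapSym_z_le (hN : 1 ≤ N) {m2 : ℝ} (hm2 : 0 ≤ m2) :
    ∑ q ∈ (Finset.univ : Finset (Tor (cM M₀))).erase 0,
        1 / lapSym (fine N (cM M₀)) ((N : ℝ) ^ 2) m2 (z N (cM M₀) q) ≤ (5 / 4) * (M₀ : ℝ) ^ 4 := by
  have hM : (0 : ℝ) < M₀ := by exact_mod_cast Nat.pos_of_ne_zero (NeZero.ne M₀)
  set g : Pt → ℝ := fun w => 1 / (supNorm w : ℝ) ^ 2 with hg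
  have hg0 : ∀ w, 0 ≤ g w := fun w => by positivity
  have hterm : ∀ q ∈ (Finset.univ : Finset (Tor (cM M₀))).erase 0,
      1 / lapSym (fine N (cM M₀)) ((N : ℝ) ^ 2) m2 (z N (cM M₀) q) ≤ (M₀ : ℝ) ^ 2 / 16 * g (vOf M₀ q) := by
    intro q hq
    have hq0 : q ≠ 0 := Finset.ne_of_mem_erase hq
    have hs : 0 < supNorm (vOf M₀ q) := ((mem_annulus_iff).mp (vOf_mem_annulus M₀ hq0)).1
    have hsR : (0 : ℝ) < supNorm (vOf M₀ q) := by exact_mod_cast hs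
    have hlow := lapSym_z_ge_supNorm N M₀ hN hm2 q
    have hpos : (0 : ℝ) < 16 * (supNorm (vOf M₀ q) : ℝ) ^ 2 / (M₀ : ℝ) ^ 2 := by positivity
    calc 1 / lapSym (fine N (cM M₀)) ((N : ℝ) ^ 2) m2 (z N (cM M₀) q)
        ≤ 1 / (16 * (supNorm (vOf M₀ q) : ℝ) ^ 2 / (M₀ : ℝ) ^ 2) := one_div_le_one_div_of_le hpos hlow
      _ = (M₀ : ℝ) ^ 2 / 16 * g (vOf M₀ q) := by rw [hg]; field_simp
  have hinj : Set.InjOn (vOf M₀) ↑((Finset.univ : Finset (Tor (cM M₀))).erase 0) :=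
    fun q _ q' _ h => vOf_injective M₀ h
  have hsub : ((Finset.univ : Finset (Tor (cM M₀))).erase 0).image (vOf M₀) ⊆ annulus 4 0 (M₀ / 2) := by
    intro w hw
    obtain ⟨q, hq, rfl⟩ := Finset.mem_image.mp hw
    exact vOf_mem_annulus M₀ (Finset.ne_of_mem_erase hq)
  have hhalf : ((M₀ / 2 : ℕ) : ℝ) ≤ (M₀ : ℝ) / 2 := Nat.cast_div_le
  calc ∑ q ∈ (Finset.univ : Finset (Tor (cM M₀))).erase 0,
          1 / lapSym (fine N (cM M₀)) ((N : ℝ) ^ 2) m2 (z N (cM M₀) q)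
      ≤ ∑ q ∈ (Finset.univ : Finset (Tor (cM M₀))).erase 0, (M₀ : ℝ) ^ 2 / 16 * g (vOf M₀ q) :=
        Finset.sum_le_sum hterm
    _ = (M₀ : ℝ) ^ 2 / 16 * ∑ w ∈ ((Finset.univ : Finset (Tor (cM M₀))).erase 0).image (vOf M₀), g w := by
        rw [Finset.mul_sum, Finset.sum_image hinj]
    _ ≤ (M₀ : ℝ) ^ 2 / 16 * ∑ w ∈ annulus 4 0 (M₀ / 2), g w :=
        mul_le_mul_of_nonneg_left (Finset.sum_le_sum_of_subset_of_nonneg hsub fun w _ _ => hg0 w)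
          (by positivity)
    _ ≤ (M₀ : ℝ) ^ 2 / 16 * (80 * ((M₀ / 2 : ℕ) : ℝ) ^ 2) := by
        gcongr
        exact LargeLWindow.Split.sum_inv_sq_window_le (M₀ / 2)
    _ ≤ (M₀ : ℝ) ^ 2 / 16 * (80 * ((M₀ : ℝ) / 2) ^ 2) := by gcongr
    _ = (5 / 4) * (M₀ : ℝ) ^ 4 := by ring

/-- `|𝕋_{N·M₀}| = N⁴ M₀⁴`. [folklore] -/
theorem card_tor_fine : (Fintype.card (Tor (fine N (cM M₀))) : ℝ) = (N : ℝ) ^ 4 * (M₀ : ℝ) ^ 4 := by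
  have h := card_fine N (cM M₀)
  have hM : Fintype.card (Tor (cM M₀)) = M₀ ^ 4 := by
    simp [Tor, cM, Fintype.card_pi, ZMod.card, Finset.prod_const]
  rw [hM] at h
  exact_mod_cast h

/-- the volume-uniform constant `D(m²) = 5/2 + 2·600²·(π²/4)⁴·(4π² + m²)`. [folklore] -/
def woodburyD (m2 : ℝ) : ℝ := 5 / 2 + 2 * (600 : ℝ) ^ 2 * ((π ^ 2 / 4) ^ 4 * (4 * π ^ 2 + m2))

/-- **MAIN BOUND (d = 4, equal periods, King scaling).**  For the scalar `U = 1` site model on the torus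
`𝕋 = (ℤ/NM₀)⁴` with block side `N ≥ 1`, `a > 0`, `m² ≥ 0`, the punctured Woodbury kernel obeys, for ALL `x, x′`,
`‖R⊥(x,x′)‖ ≤ D(m²)/N⁴`, UNIFORMLY IN THE VOLUME `M₀` and in `a`.  In lattice units (`Γ_lat = N²·G_King`, §0) this is
the `D₀L⁻²` estimate of RULING (R7)(i) for the averaging correction at separations of any size. [folklore] -/
theorem norm_Rperp_le (hN : 1 ≤ N) {a m2 : ℝ} (ha : 0 < a) (hm2 : 0 ≤ m2) (x x' : Tor (fine N (cM M₀))) :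
    ‖Rperp N (cM M₀) a m2 x x'‖ ≤ woodburyD m2 / (N : ℝ) ^ 4 := by
  have hM : (0 : ℝ) < M₀ := by exact_mod_cast Nat.pos_of_ne_zero (NeZero.ne M₀)
  have hNr : (0 : ℝ) < N := by exact_mod_cast (show 0 < N by omega)
  have hcard := card_tor_fine N M₀
  have hcardC : ((Fintype.card (Tor (fine N (cM M₀))) : ℂ)) = (((N : ℝ) ^ 4 * (M₀ : ℝ) ^ 4 : ℝ) : ℂ) := by
    rw [← hcard]; push_cast; rfl
  set B := (π ^ 2 / 4) ^ 4 * (4 * π ^ 2 + m2) with hB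
  have hB0 : 0 ≤ B := by positivity
  have hsum : ∑ q ∈ (Finset.univ : Finset (Tor (cM M₀))).erase 0,
      ‖(kap N (cM M₀) a ((N : ℝ) ^ 2) m2 q : ℂ) * famp N (cM M₀) m2 q x * conj (famp N (cM M₀) m2 q x')‖
        ≤ (5 / 2) * (M₀ : ℝ) ^ 4 + (M₀ : ℝ) ^ 4 * (2 * aliasC 4 ^ 2 * B) := by
    have hcnt : (((Finset.univ : Finset (Tor (cM M₀))).erase 0).card : ℝ) ≤ (M₀ : ℝ) ^ 4 := by
      have h1 : ((Finset.univ : Finset (Tor (cM M₀))).erase 0).card ≤ Fintype.card (Tor (cM M₀)) :=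
        (Finset.card_erase_le).trans (Finset.card_univ.le)
      have h2 : Fintype.card (Tor (cM M₀)) = M₀ ^ 4 := by
        simp [Tor, cM, Fintype.card_pi, ZMod.card, Finset.prod_const]
      rw [h2] at h1
      exact_mod_cast h1
    calc ∑ q ∈ (Finset.univ : Finset (Tor (cM M₀))).erase 0,
          ‖(kap N (cM M₀) a ((N : ℝ) ^ 2) m2 q : ℂ) * famp N (cM M₀) m2 q x * conj (famp N (cM M₀) m2 q x')‖
        ≤ ∑ q ∈ (Finset.univ : Finset (Tor (cM M₀))).erase 0,
            (2 / lapSym (fine N (cM M₀)) ((N : ℝ) ^ 2) m2 (z N (cM M₀) q) + 2 * aliasC 4 ^ 2 * B) := by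
          refine Finset.sum_le_sum fun q hq => ?_
          have h := fibre_term_le N (cM M₀) (by norm_num) hN ha hm2 (Finset.ne_of_mem_erase hq) x x'
          simpa [hB] using h
      _ = 2 * ∑ q ∈ (Finset.univ : Finset (Tor (cM M₀))).erase 0,
            1 / lapSym (fine N (cM M₀)) ((N : ℝ) ^ 2) m2 (z N (cM M₀) q)
          + (((Finset.univ : Finset (Tor (cM M₀))).erase 0).card : ℝ) * (2 * aliasC 4 ^ 2 * B) := by
          rw [Finset.sum_add_distrib, Finset.sum_const, nsmul_eq_mul, Finset.mul_sum]
          congr 1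
          exact Finset.sum_congr rfl fun q _ => by ring
      _ ≤ 2 * ((5 / 4) * (M₀ : ℝ) ^ 4) + (M₀ : ℝ) ^ 4 * (2 * aliasC 4 ^ 2 * B) := by
          gcongr
          · exact sum_inv_lapSym_z_le N M₀ hN hm2
      _ = _ := by ring
  unfold Rperp
  rw [norm_mul, norm_inv, hcardC, Complex.norm_real, Real.norm_eq_abs, abs_of_pos (by positivity)]
  calc ((N : ℝ) ^ 4 * (M₀ : ℝ) ^ 4)⁻¹ *
        ‖∑ q ∈ (Finset.univ : Finset (Tor (cM M₀))).erase 0,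
          (kap N (cM M₀) a ((N : ℝ) ^ 2) m2 q : ℂ) * famp N (cM M₀) m2 q x * conj (famp N (cM M₀) m2 q x')‖
      ≤ ((N : ℝ) ^ 4 * (M₀ : ℝ) ^ 4)⁻¹ * ((5 / 2) * (M₀ : ℝ) ^ 4 + (M₀ : ℝ) ^ 4 * (2 * aliasC 4 ^ 2 * B)) := by
        refine mul_le_mul_of_nonneg_left ((norm_sum_le _ _).trans hsum) (by positivity)
    _ = woodburyD m2 / (N : ℝ) ^ 4 := by
        rw [woodburyD, aliasC_four, hB]
        field_simp

end Four

/-! ## §5 The exact identification: `G = G_free^⊥ + |𝕋|⁻¹(m²+a)⁻¹ − R⊥` (kernel inversion of King's fibre inverse) -/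

section Exact

variable (N : ℕ) [NeZero N] (M : Fin d → ℕ) [hM : ∀ μ, NeZero (M μ)]

/-- orthogonality in the form used twice below: `Σ_p e^{−ip·s} e^{ip·t} = |𝕋|·[t = s]`. [folklore] -/
theorem sum_conj_chi_mul_chi (K : Fin d → ℕ) [∀ μ, NeZero (K μ)] (s t : Tor K) :
    ∑ p, conj (chi K p s) * chi K p t = if t - s = 0 then (Fintype.card (Tor K) : ℂ) else 0 := by
  simp_rw [conj_chi_mul_chi]
  exact sum_chi_left K (t - s)

/-- **KERNEL INVERSION**: a real operator is recovered from its momentum kernel,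
`|𝕋|² T(x,x′) = Σ_{p,p′} e^{−ip·x} T̂(p,p′) e^{ip′·x′}`. [folklore] -/
theorem kernel_inversion (K : Fin d → ℕ) [∀ μ, NeZero (K μ)] (T : Matrix (Tor K) (Tor K) ℝ) (x x' : Tor K) :
    ∑ p, ∑ p', conj (chi K p x) * hat K T p p' * chi K p' x'
      = ((Fintype.card (Tor K) : ℂ)) ^ 2 * (T x x' : ℂ) := by
  have hgen := sum_conj_chi_mul_chi K
  calc ∑ p, ∑ p', conj (chi K p x) * hat K T p p' * chi K p' x'
      = ∑ p, ∑ p', ∑ y, ∑ y',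
          (conj (chi K p x) * chi K p y) * (T y y' : ℂ) * (conj (chi K p' y') * chi K p' x') := by
        refine Finset.sum_congr rfl fun p _ => Finset.sum_congr rfl fun p' _ => ?_
        unfold hat
        rw [Finset.mul_sum, Finset.sum_mul]
        refine Finset.sum_congr rfl fun y _ => ?_
        rw [Finset.mul_sum, Finset.sum_mul]
        refine Finset.sum_congr rfl fun y' _ => ?_
        ring
    _ = ∑ y, ∑ y', ∑ p, ∑ p',
          (conj (chi K p x) * chi K p y) * (T y y' : ℂ) * (conj (chi K p' y') * chi K p' x') :=
        (sum_comm4 (fun y y' p p' =>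
          (conj (chi K p x) * chi K p y) * (T y y' : ℂ) * (conj (chi K p' y') * chi K p' x'))).symm
    _ = ∑ y, ∑ y', (T y y' : ℂ) *
          ((∑ p, conj (chi K p x) * chi K p y) * (∑ p', conj (chi K p' y') * chi K p' x')) := by
        refine Finset.sum_congr rfl fun y _ => Finset.sum_congr rfl fun y' _ => ?_
        rw [Finset.sum_mul_sum, Finset.mul_sum]
        refine Finset.sum_congr rfl fun p _ => ?_
        rw [Finset.mul_sum]
        refine Finset.sum_congr rfl fun p' _ => ?_
        ring
    _ = ((Fintype.card (Tor K) : ℂ)) ^ 2 * (T x x' : ℂ) := by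
        simp_rw [hgen]
        rw [Finset.sum_eq_single x]
        · rw [Finset.sum_eq_single x']
          · simp [sq]; ring
          · intro y' _ hy'
            rw [if_neg (sub_ne_zero.mpr (Ne.symm hy'))]; ring
          · intro h; exact absurd (Finset.mem_univ x') h
        · intro y _ hy
          refine Finset.sum_eq_zero fun y' _ => ?_
          rw [if_neg (sub_ne_zero.mpr hy)]; ring
        · intro h; exact absurd (Finset.mem_univ x) h

/-- **Regrouping by fibres**: `Σ_{p,p′: red p′ = red p} Φ(red p) f(p) g(p′) = Σ_q Φ(q)(Σ_{fib q} f)(Σ_{fib q} g)`.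
[folklore] -/
theorem sum_red_pair (Φ : Tor M → ℂ) (f g : Tor (fine N M) → ℂ) :
    ∑ p, ∑ p', (if red N M p' = red N M p then Φ (red N M p) * f p * g p' else 0)
      = ∑ q, Φ q * (∑ p ∈ fib N M q, f p) * (∑ p' ∈ fib N M q, g p') := by
  have h1 : ∀ p, ∑ p', (if red N M p' = red N M p then Φ (red N M p) * f p * g p' else 0)
      = ∑ p' ∈ fib N M (red N M p), Φ (red N M p) * f p * g p' := by
    intro p
    rw [Finset.sum_filter]
  simp_rw [h1]
  rw [← Finset.sum_fiberwise Finset.univ (red N M)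
    (fun p => ∑ p' ∈ fib N M (red N M p), Φ (red N M p) * f p * g p')]
  refine Finset.sum_congr rfl fun q _ => ?_
  rw [mul_assoc, Finset.sum_mul_sum, Finset.mul_sum]
  refine Finset.sum_congr rfl fun p hp => ?_
  have hq : red N M p = q := (Finset.mem_filter.mp hp).2
  rw [hq, Finset.mul_sum]
  exact Finset.sum_congr rfl fun p' _ => by ring

/-- THE PUNCTURED FREE PROPAGATOR `G_free^⊥(w) = |𝕋|⁻¹ Σ_{p ≠ 0} e^{ip·w}/σ(p)` (King scaling). [folklore] -/
def GfreePerp (m2 : ℝ) (w : Tor (fine N M)) : ℂ :=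
  ((Fintype.card (Tor (fine N M)) : ℂ))⁻¹ *
    ∑ p ∈ (Finset.univ : Finset (Tor (fine N M))).erase 0, chi (fine N M) p w / (lapSym (fine N M) ((N : ℝ) ^ 2) m2 p : ℂ)

/-- `σ(0) = m²`. [folklore] -/
theorem lapSym_zero (K : Fin d → ℕ) [∀ μ, NeZero (K μ)] (c m2 : ℝ) : lapSym K c m2 0 = m2 := by
  unfold lapSym
  simp [B5Prop11Plancherel.sOf_zero]

omit [NeZero N] hM in
/-- `z 0 = 0`. [folklore] -/
theorem z_zero : z N M 0 = 0 := by
  funext μ; simp [z]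

/-- `u(0) = 1` (the block average of the constant `1`). [folklore] -/
theorem u_zero : u N M 0 = 1 := by
  unfold u
  simp_rw [chi_zero_left]
  rw [Finset.sum_const, Finset.card_univ, Fintype.card_pi, Finset.prod_const, Finset.card_univ,
    Fintype.card_fin, Fintype.card_fin]
  have hN : (N : ℂ) ≠ 0 := by exact_mod_cast NeZero.ne N
  simp [hN]

/-- off the central alias the zero fibre carries no weight: `u(pOf(m,0)) = 0` for `m ≠ 0` (`N ≥ 1`). [folklore] -/
theorem u_pOf_zero_eq_zero (hN : 1 ≤ N) {m : Fin d → Fin N} (hm : m ≠ fun _ => 0) :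
    u N M (pOf N M (m, 0)) = 0 := by
  have h := norm_sq_u_pOf N M hN m 0
  rw [B5Prop11Plancherel.sOf_zero] at h
  obtain ⟨μ, hμ⟩ : ∃ μ, (m μ : ℕ) ≠ 0 := by
    by_contra hcon
    push Not at hcon
    exact hm (funext fun μ => Fin.ext (by simpa using hcon μ))
  have hUr : Ur N m (0 : Fin d → ℝ) = 0 := by
    unfold Ur
    exact Finset.prod_eq_zero (Finset.mem_univ μ) (by
      rw [Pi.zero_apply, King1986.uFactorr_zero_left, if_neg hμ])
  rw [hUr] at h
  exact norm_eq_zero.mp (pow_eq_zero_iff two_ne_zero |>.mp h)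

/-- the zero-fibre amplitude: `A_0(x) = 1/m²`. [folklore] -/
theorem famp_zero (hN : 1 ≤ N) (m2 : ℝ) (x : Tor (fine N M)) : famp N M m2 0 x = 1 / (m2 : ℂ) := by
  unfold famp
  rw [sum_fib_eq_sum_pOf, ← Finset.add_sum_erase _ _ (Finset.mem_univ (fun _ => (0 : Fin N))),
    pOf_zero_eq_z, z_zero, u_zero, chi_zero_left, lapSym_zero, map_one, one_mul,
    Finset.sum_eq_zero (fun m hm => by rw [u_pOf_zero_eq_zero N M hN (Finset.ne_of_mem_erase hm)]; simp), add_zero,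
    one_div]

/-- the zero-fibre sum: `S(0) = 1/m²`. [folklore] -/
theorem Sfib_zero (hN : 1 ≤ N) (m2 : ℝ) : Sfib N M ((N : ℝ) ^ 2) m2 0 = 1 / m2 := by
  unfold Sfib
  rw [sum_fib_eq_sum_pOf, ← Finset.add_sum_erase _ _ (Finset.mem_univ (fun _ => (0 : Fin N))),
    pOf_zero_eq_z, z_zero, u_zero, lapSym_zero, norm_one, one_pow,
    Finset.sum_eq_zero (fun m hm => by rw [u_pOf_zero_eq_zero N M hN (Finset.ne_of_mem_erase hm)]; simp), add_zero]

/-- **THE EXACT DECOMPOSITION (P0).**  For the scalar `U = 1` site model `G = (−N²Δ + m² + aQ*Q)⁻¹` on the torus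
`(ℤ/N·M)^d` (King scaling, `a ≥ 0`, `m² > 0`, `N ≥ 1`):
`G(x,x′) = G_free^⊥(x′−x) + |𝕋|⁻¹(m²+a)⁻¹ − R⊥(x,x′)`,
i.e. the Woodbury/averaging correction `R_W = G_free − G` equals the punctured fibre sum `R⊥` up to the EXACTLY
EVALUATED zero fibre (a volume-suppressed constant).  Proof: kernel inversion + King's fibre inverse `hat_fineOp_inv`
(Sherman–Morrison per fibre) + `A_0 ≡ 1/m²`, `S(0) = 1/m²`, `κ(0) = am²/(m²+a)`. [cite: King1986, (4.9)–(4.12) p.671;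
folklore (Sherman–Morrison–Woodbury)] -/
theorem fineOp_inv_decomposition (hN : 1 ≤ N) {a m2 : ℝ} (ha : 0 ≤ a) (hm : 0 < m2) (x x' : Tor (fine N M)) :
    (((fineOp N M a ((N : ℝ) ^ 2) m2)⁻¹ x x' : ℝ) : ℂ)
      = GfreePerp N M m2 (x' - x) + ((Fintype.card (Tor (fine N M)) : ℂ))⁻¹ * (1 / ((m2 : ℂ) + a))
          - Rperp N M a m2 x x' := by
  set V : ℂ := (Fintype.card (Tor (fine N M)) : ℂ) with hV
  have hV0 : V ≠ 0 := by rw [hV]; exact_mod_cast Fintype.card_ne_zero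
  have hm0 : (m2 : ℂ) ≠ 0 := by exact_mod_cast hm.ne'
  have hma : (m2 : ℂ) + a ≠ 0 := by
    have : (0 : ℝ) < m2 + a := by linarith
    exact_mod_cast this.ne'
  set σ : Tor (fine N M) → ℝ := fun p => lapSym (fine N M) ((N : ℝ) ^ 2) m2 p with hσdef
  -- kernel inversion with King's fibre inverse
  have hinv := kernel_inversion (fine N M) (fineOp N M a ((N : ℝ) ^ 2) m2)⁻¹ x x'
  have hhat : ∀ p p', hat (fine N M) (fineOp N M a ((N : ℝ) ^ 2) m2)⁻¹ p p'
      = V * (if red N M p' = red N M p then Cfib N M a ((N : ℝ) ^ 2) m2 (red N M p) p p' else 0) :=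
    fun p p' => hat_fineOp_inv N M ha (by positivity) hm p p'
  simp_rw [hhat] at hinv
  -- split `Cfib` into its diagonal and rank-one parts
  have hsplit : ∑ p, ∑ p', conj (chi (fine N M) p x)
        * (V * (if red N M p' = red N M p then Cfib N M a ((N : ℝ) ^ 2) m2 (red N M p) p p' else 0))
        * chi (fine N M) p' x'
      = V * (∑ p, conj (chi (fine N M) p x) * chi (fine N M) p x' / (σ p : ℂ))
        - V * ∑ p, ∑ p', (if red N M p' = red N M p then
            (kap N M a ((N : ℝ) ^ 2) m2 (red N M p) : ℂ)
              * (conj (chi (fine N M) p x) * (u N M p / (σ p : ℂ)))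
              * (conj (u N M p') / (σ p' : ℂ) * chi (fine N M) p' x') else 0) := by
    rw [Finset.mul_sum, Finset.mul_sum, ← Finset.sum_sub_distrib]
    refine Finset.sum_congr rfl fun p _ => ?_
    -- the p'-sum of the diagonal part collapses to p' = p
    have hdiag : V * (conj (chi (fine N M) p x) * chi (fine N M) p x' / (σ p : ℂ))
        = ∑ p', (if p' = p then V * (conj (chi (fine N M) p x) * chi (fine N M) p x' / (σ p : ℂ)) else 0) := by
      rw [Finset.sum_ite_eq' Finset.univ p, if_pos (Finset.mem_univ p)]
    rw [hdiag, Finset.mul_sum, ← Finset.sum_sub_distrib]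
    refine Finset.sum_congr rfl fun p' _ => ?_
    by_cases hr : red N M p' = red N M p
    · rw [if_pos hr, if_pos hr]
      unfold Cfib
      by_cases hpp : p' = p
      · subst hpp
        rw [if_pos rfl, if_pos rfl]
        simp only [hσdef]
        ring
      · rw [if_neg hpp, if_neg (Ne.symm hpp)]
        simp only [hσdef]
        ring
    · rw [if_neg hr, if_neg hr]
      have hpp : p' ≠ p := fun h => hr (by rw [h])
      rw [if_neg hpp]
      ring
  rw [hsplit] at hinv
  -- the diagonal part: `Σ_p e^{ip(x′−x)}/σ(p) = 1/m² + V·G_free^⊥(x′−x)`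
  have hfree : ∑ p, conj (chi (fine N M) p x) * chi (fine N M) p x' / (σ p : ℂ)
      = 1 / (m2 : ℂ) + V * GfreePerp N M m2 (x' - x) := by
    unfold GfreePerp
    rw [← mul_assoc, ← hV, mul_inv_cancel₀ hV0, one_mul,
      ← Finset.add_sum_erase _ _ (Finset.mem_univ (0 : Tor (fine N M)))]
    congr 1
    · rw [chi_zero_left, chi_zero_left, map_one]
      simp only [hσdef]
      rw [lapSym_zero]; ring
    · refine Finset.sum_congr rfl fun p _ => ?_
      rw [conj_chi_mul_chi]
  -- the rank-one part regrouped by fibres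
  have hrank : ∑ p, ∑ p', (if red N M p' = red N M p then
        (kap N M a ((N : ℝ) ^ 2) m2 (red N M p) : ℂ)
          * (conj (chi (fine N M) p x) * (u N M p / (σ p : ℂ)))
          * (conj (u N M p') / (σ p' : ℂ) * chi (fine N M) p' x') else 0)
      = ∑ q, (kap N M a ((N : ℝ) ^ 2) m2 q : ℂ) * famp N M m2 q x * conj (famp N M m2 q x') := by
    rw [sum_red_pair N M (fun q => (kap N M a ((N : ℝ) ^ 2) m2 q : ℂ))
      (fun p => conj (chi (fine N M) p x) * (u N M p / (σ p : ℂ)))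
      (fun p' => conj (u N M p') / (σ p' : ℂ) * chi (fine N M) p' x')]
    refine Finset.sum_congr rfl fun q _ => ?_
    unfold famp
    rw [map_sum]
    congr 1
    refine Finset.sum_congr rfl fun p' _ => ?_
    rw [map_mul, map_div₀, Complex.conj_conj, Complex.conj_ofReal]
    simp only [hσdef]
    ring
  rw [hfree, hrank, ← Finset.add_sum_erase _ _ (Finset.mem_univ (0 : Tor M)), famp_zero N M hN,
    famp_zero N M hN] at hinv
  -- the zero fibre, exactly
  have hk0 : (kap N M a ((N : ℝ) ^ 2) m2 0 : ℂ) = (a : ℂ) * m2 / ((m2 : ℂ) + a) := by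
    unfold kap
    rw [Sfib_zero N M hN]
    have : (1 : ℝ) + a * (1 / m2) = (m2 + a) / m2 := by field_simp
    rw [this]
    push_cast
    field_simp
  rw [hk0] at hinv
  -- solve for `G x x'`
  have hR : ∑ q ∈ Finset.univ.erase (0 : Tor M),
        (kap N M a ((N : ℝ) ^ 2) m2 q : ℂ) * famp N M m2 q x * conj (famp N M m2 q x')
      = V * Rperp N M a m2 x x' := by
    unfold Rperp
    rw [← mul_assoc, ← hV, mul_inv_cancel₀ hV0, one_mul]
  rw [hR] at hinv
  have hVV : V ^ 2 ≠ 0 := pow_ne_zero 2 hV0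
  apply mul_left_cancel₀ hVV
  rw [← hinv]
  rw [map_div₀, map_one, Complex.conj_ofReal]
  field_simp
  ring

end Exact

/-! ## §6 Differenced kernels: `∇_x R⊥ = O(N⁻⁵)`, `∇_x∇_{x′} R⊥ = O(N⁻⁶)` (each lattice difference gains `N⁻¹`) -/

section Diff

variable (N : ℕ) [NeZero N] (M : Fin d → ℕ) [hM : ∀ μ, NeZero (M μ)]

/-- the half-power alias mass `Y₂(q) = Σ_{m ≠ 0} |u(p′+2πm)|/√σ(p′+2πm)`. [folklore] -/
def Yoff2 (m2 : ℝ) (q : Tor M) : ℝ :=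
  ∑ m ∈ (Finset.univ : Finset (Fin d → Fin N)).erase (fun _ => 0),
    ‖u N M (pOf N M (m, q))‖ / Real.sqrt (lapSym (fine N M) ((N : ℝ) ^ 2) m2 (pOf N M (m, q)))

/-- `Y₂(q) ≥ 0`. [folklore] -/
theorem Yoff2_nonneg (m2 : ℝ) (q : Tor M) : 0 ≤ Yoff2 N M m2 q := by
  unfold Yoff2
  exact Finset.sum_nonneg fun m _ => div_nonneg (norm_nonneg _) (Real.sqrt_nonneg _)

/-- `Y(q) ≥ 0`. [folklore] -/
theorem Yoff_nonneg {m2 : ℝ} (hm2 : 0 ≤ m2) (q : Tor M) : 0 ≤ Yoff N M m2 q := by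
  unfold Yoff
  exact Finset.sum_nonneg fun m _ => div_nonneg (norm_nonneg _) (lapSym_nonneg _ (by positivity) hm2 _)

/-- `Y₂(q) ≤ C′_Y(d)`. [cite: King1986, (4.22) p.672] -/
theorem Yoff2_le (hd : 0 < d) (hN : 1 ≤ N) {m2 : ℝ} (hm2 : 0 ≤ m2) (q : Tor M) : Yoff2 N M m2 q ≤ aliasC2 d := by
  unfold Yoff2
  simp_rw [lapSym_pOf]
  exact offCentre_sqrt_sum_le hd hN hm2 (abs_sOf_le M q) (fun m => ‖u N M (pOf N M (m, q))‖)
    (fun m => norm_nonneg _) (fun m => norm_sq_u_pOf N M hN m q)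

/-- **One lattice difference costs `√σ(p)/N`**: `|e^{ip·e_μ} − 1| = 2|sin(p_μ/2)| = √(S₁(p_μ)) ≤ √σ(p)/N`
(`σ(p) = m² + N² Σ_ν S₁(p_ν)`). [folklore] -/
theorem norm_chi_unitVec_sub_one_le {m2 : ℝ} (hm2 : 0 ≤ m2) (p : Tor (fine N M)) (μ : Fin d) :
    ‖chi (fine N M) p (B5Prop11Plancherel.unitVec (fine N M) μ) - 1‖
      ≤ Real.sqrt (lapSym (fine N M) ((N : ℝ) ^ 2) m2 p) / N := by
  have hNr : (0 : ℝ) < N := by exact_mod_cast Nat.pos_of_ne_zero (NeZero.ne N)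
  rw [chi_unitVec_eq_exp, mul_comm, Complex.norm_exp_I_mul_ofReal_sub_one, Real.norm_eq_abs,
    le_div_iff₀ hNr]
  have eabs : |2 * Real.sin (sOf (fine N M) p μ / 2)| * (N : ℝ) = |2 * Real.sin (sOf (fine N M) p μ / 2) * N| := by
    rw [abs_mul (2 * Real.sin _) (N : ℝ), abs_of_pos hNr]
  rw [eabs]
  apply Real.abs_le_sqrt
  -- `(2 sin(s/2) · N)² = N² S₁(s) ≤ σ(p)`
  have hs2 : Real.sin (sOf (fine N M) p μ / 2) ^ 2 = 1 / 2 - Real.cos (sOf (fine N M) p μ) / 2 := by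
    rw [Real.sin_sq_eq_half_sub, show 2 * (sOf (fine N M) p μ / 2) = sOf (fine N M) p μ by ring]
  have h1 : (2 * Real.sin (sOf (fine N M) p μ / 2) * N) ^ 2
      = (N : ℝ) ^ 2 * (2 - 2 * Real.cos (sOf (fine N M) p μ)) := by
    have : (2 * Real.sin (sOf (fine N M) p μ / 2) * N) ^ 2
        = 4 * (N : ℝ) ^ 2 * Real.sin (sOf (fine N M) p μ / 2) ^ 2 := by ring
    rw [this, hs2]
    ring
  rw [h1]
  unfold lapSym
  have h2 : (2 - 2 * Real.cos (sOf (fine N M) p μ)) ≤ ∑ ν : Fin d, (2 - 2 * Real.cos (sOf (fine N M) p ν)) :=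
    Finset.single_le_sum (f := fun ν => 2 - 2 * Real.cos (sOf (fine N M) p ν))
      (fun ν _ => by linarith [Real.cos_le_one (sOf (fine N M) p ν)]) (Finset.mem_univ μ)
  nlinarith [sq_nonneg (N : ℝ)]

/-- THE DIFFERENCED FIBRE AMPLITUDE `∇_μ A_q(x) = A_q(x + e_μ) − A_q(x)`. [folklore] -/
def dfamp (m2 : ℝ) (q : Tor M) (μ : Fin d) (x : Tor (fine N M)) : ℂ :=
  famp N M m2 q (x + B5Prop11Plancherel.unitVec (fine N M) μ) - famp N M m2 q x

/-- **(B1′)** `|∇_μ A_q(x)| ≤ (|u(z q)|/√σ(z q) + Y₂(q))/N`. [folklore] -/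
theorem norm_dfamp_le (hN : 1 ≤ N) {m2 : ℝ} (hm2 : 0 ≤ m2) (q : Tor M) (μ : Fin d) (x : Tor (fine N M)) :
    ‖dfamp N M m2 q μ x‖
      ≤ (‖u N M (z N M q)‖ / Real.sqrt (lapSym (fine N M) ((N : ℝ) ^ 2) m2 (z N M q)) + Yoff2 N M m2 q) / N := by
  have hNr : (0 : ℝ) < N := by exact_mod_cast (show 0 < N by omega)
  have hσ0 : ∀ p, 0 ≤ lapSym (fine N M) ((N : ℝ) ^ 2) m2 p := fun p => lapSym_nonneg _ (by positivity) hm2 p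
  set e := B5Prop11Plancherel.unitVec (fine N M) μ with he
  have hexp : dfamp N M m2 q μ x = ∑ p ∈ fib N M q,
      conj (chi (fine N M) p x) * (conj (chi (fine N M) p e) - 1)
        * (u N M p / (lapSym (fine N M) ((N : ℝ) ^ 2) m2 p : ℂ)) := by
    unfold dfamp famp
    rw [← Finset.sum_sub_distrib]
    refine Finset.sum_congr rfl fun p _ => ?_
    rw [B5Prop11Plancherel.chi_add_right, map_mul]
    ring
  rw [hexp]
  calc ‖∑ p ∈ fib N M q, conj (chi (fine N M) p x) * (conj (chi (fine N M) p e) - 1)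
          * (u N M p / (lapSym (fine N M) ((N : ℝ) ^ 2) m2 p : ℂ))‖
      ≤ ∑ p ∈ fib N M q, ‖conj (chi (fine N M) p x) * (conj (chi (fine N M) p e) - 1)
          * (u N M p / (lapSym (fine N M) ((N : ℝ) ^ 2) m2 p : ℂ))‖ := norm_sum_le _ _
    _ ≤ ∑ p ∈ fib N M q, (Real.sqrt (lapSym (fine N M) ((N : ℝ) ^ 2) m2 p) / N)
          * (‖u N M p‖ / lapSym (fine N M) ((N : ℝ) ^ 2) m2 p) := by
        refine Finset.sum_le_sum fun p _ => ?_
        rw [norm_mul, norm_mul, Complex.norm_conj, norm_chi, one_mul, norm_div, Complex.norm_real,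
          Real.norm_eq_abs, abs_of_nonneg (hσ0 p)]
        refine mul_le_mul_of_nonneg_right ?_ (div_nonneg (norm_nonneg _) (hσ0 p))
        have h := norm_chi_unitVec_sub_one_le N M hm2 p μ
        rwa [← Complex.norm_conj, map_sub, map_one] at h
    _ = (∑ p ∈ fib N M q, ‖u N M p‖ / Real.sqrt (lapSym (fine N M) ((N : ℝ) ^ 2) m2 p)) / N := by
        rw [Finset.sum_div]
        refine Finset.sum_congr rfl fun p _ => ?_
        by_cases h0 : lapSym (fine N M) ((N : ℝ) ^ 2) m2 p = 0
        · rw [h0]; simp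
        · have hpos : 0 < lapSym (fine N M) ((N : ℝ) ^ 2) m2 p := lt_of_le_of_ne (hσ0 p) (Ne.symm h0)
          have hs : Real.sqrt (lapSym (fine N M) ((N : ℝ) ^ 2) m2 p) ≠ 0 := (Real.sqrt_pos.mpr hpos).ne'
          rw [div_mul_div_comm, div_div, div_eq_div_iff (mul_ne_zero hNr.ne' hpos.ne') (mul_ne_zero hs hNr.ne')]
          linear_combination (‖u N M p‖ * (N : ℝ)) * Real.sq_sqrt hpos.le
    _ = _ := by
        rw [sum_fib_eq_sum_pOf N M q _, ← Finset.add_sum_erase _ _ (Finset.mem_univ (fun _ => (0 : Fin N))),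
          pOf_zero_eq_z]
        rfl

/-- `|u(z q)| ≥ (2/π)^d`. [cite: King1986, (4.37) p.674] -/
theorem norm_u_central_ge (hN : 1 ≤ N) (q : Tor M) : (2 / π) ^ d ≤ ‖u N M (z N M q)‖ := by
  have h := norm_sq_u_central N M hN q
  have e : (4 / π ^ 2) ^ d = ((2 / π) ^ d) ^ 2 := by
    rw [← pow_mul, mul_comm, pow_mul]; congr 1; ring
  rw [e] at h
  exact (pow_le_pow_iff_left₀ (by positivity) (norm_nonneg _) two_ne_zero).mp h

/-- the mixed-term constant `E₁(d, m²)`. [folklore] -/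
def mixedE (d : ℕ) (m2 : ℝ) : ℝ :=
  (π / 2) ^ d * ((1 + (d * π ^ 2 + m2)) / 2 * aliasC d + aliasC2 d)
    + ((π / 2) ^ d) ^ 2 * (d * π ^ 2 + m2) * aliasC d * aliasC2 d

/-- the double-difference constant `E₂(d, m²)`. [folklore] -/
def doubleE (d : ℕ) (m2 : ℝ) : ℝ :=
  1 + (1 + (d * π ^ 2 + m2)) * (π / 2) ^ d * aliasC2 d + (d * π ^ 2 + m2) * ((π / 2) ^ d) ^ 2 * aliasC2 d ^ 2

/-- **(B4′) THE MIXED PER-FIBRE BOUND**: `‖κ(q) ∇_μA_q(x) conj A_q(x′)‖ ≤ (1/√σ(z q) + E₁)/N` for `q ≠ 0`.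
[cite: King1986, (4.20)–(4.22) p.672] -/
theorem mixed_term_le (hd : 0 < d) (hN : 1 ≤ N) {a m2 : ℝ} (ha : 0 < a) (hm2 : 0 ≤ m2) {q : Tor M} (hq : q ≠ 0)
    (μ : Fin d) (x x' : Tor (fine N M)) :
    ‖(kap N M a ((N : ℝ) ^ 2) m2 q : ℂ) * dfamp N M m2 q μ x * conj (famp N M m2 q x')‖
      ≤ (1 / Real.sqrt (lapSym (fine N M) ((N : ℝ) ^ 2) m2 (z N M q)) + mixedE d m2) / N := by
  have hNr : (0 : ℝ) < N := by exact_mod_cast (show 0 < N by omega)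
  set S := lapSym (fine N M) ((N : ℝ) ^ 2) m2 (z N M q) with hS
  set A := ‖u N M (z N M q)‖ with hA
  set κ := kap N M a ((N : ℝ) ^ 2) m2 q with hκ
  set Y := Yoff N M m2 q with hY
  set Y₂ := Yoff2 N M m2 q with hY₂
  set t := Real.sqrt S with ht
  have hSpos : 0 < S := lapSym_z_pos N M hN hm2 hq
  have htpos : 0 < t := Real.sqrt_pos.mpr hSpos
  have htS : t * t = S := Real.mul_self_sqrt hSpos.le
  have hc0 : 0 < (2 / π) ^ d := by positivity
  have hAge : (2 / π) ^ d ≤ A := norm_u_central_ge N M hN q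
  have hApos : 0 < A := lt_of_lt_of_le hc0 hAge
  have hAinv : A⁻¹ ≤ (π / 2) ^ d := by
    have := inv_anti₀ hc0 hAge
    rwa [← inv_pow, inv_div] at this
  have hκ0 : 0 ≤ κ := kap_nonneg' N M ha.le hm2 q
  have hκle : κ ≤ S / A ^ 2 := kap_le N M hN ha hm2 hq
  have hY0 : 0 ≤ Y := Yoff_nonneg N M hm2 q
  have hYC : Y ≤ aliasC d := Yoff_le N M hd hN hm2 q
  have hY20 : 0 ≤ Y₂ := Yoff2_nonneg N M m2 q
  have hY2C : Y₂ ≤ aliasC2 d := Yoff2_le N M hd hN hm2 q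
  have hSle : S ≤ d * π ^ 2 + m2 := lapSym_z_le N M q
  have hC0 : 0 ≤ aliasC d := aliasC_nonneg d
  have hC20 : 0 ≤ aliasC2 d := aliasC2_nonneg d
  have htle : t ≤ (1 + (d * π ^ 2 + m2)) / 2 := by nlinarith [sq_nonneg (t - 1)]
  -- the two amplitude bounds
  have hA1 : ‖dfamp N M m2 q μ x‖ ≤ (A / t + Y₂) / N := norm_dfamp_le N M hN hm2 q μ x
  have hA0 : ‖famp N M m2 q x'‖ ≤ A / S + Y := norm_famp_le N M hN hm2 q x'
  have hΦ1 : 0 ≤ (A / t + Y₂) / N := by positivity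
  have hΦ0 : 0 ≤ A / S + Y := by positivity
  have h1 : ‖(κ : ℂ) * dfamp N M m2 q μ x * conj (famp N M m2 q x')‖ ≤ κ * (((A / t + Y₂) / N) * (A / S + Y)) := by
    rw [norm_mul, norm_mul, Complex.norm_conj, Complex.norm_real, Real.norm_eq_abs, abs_of_nonneg hκ0, mul_assoc]
    exact mul_le_mul_of_nonneg_left (mul_le_mul hA1 hA0 (norm_nonneg _) hΦ1) hκ0
  -- replace κ by S/A² and expand
  have h2 : κ * (((A / t + Y₂) / N) * (A / S + Y)) ≤ S / A ^ 2 * (((A / t + Y₂) / N) * (A / S + Y)) :=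
    mul_le_mul_of_nonneg_right hκle (by positivity)
  have h3 : S / A ^ 2 * (((A / t + Y₂) / N) * (A / S + Y))
      = (1 / t + (t * Y * A⁻¹ + Y₂ * A⁻¹ + S * Y * Y₂ * A⁻¹ ^ 2)) / N := by
    rw [← htS]
    field_simp
    ring
  -- bound the three `O(1)` terms
  have hb1 : t * Y * A⁻¹ ≤ (1 + (d * π ^ 2 + m2)) / 2 * aliasC d * (π / 2) ^ d :=
    mul_le_mul (mul_le_mul htle hYC hY0 (by positivity)) hAinv (by positivity) (by positivity)
  have hb2 : Y₂ * A⁻¹ ≤ aliasC2 d * (π / 2) ^ d := mul_le_mul hY2C hAinv (by positivity) (by positivity)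
  have hb3 : S * Y * Y₂ * A⁻¹ ^ 2 ≤ (d * π ^ 2 + m2) * aliasC d * aliasC2 d * ((π / 2) ^ d) ^ 2 := by
    have := pow_le_pow_left₀ (by positivity) hAinv 2
    exact mul_le_mul (mul_le_mul (mul_le_mul hSle hYC hY0 (by positivity)) hY2C hY20 (by positivity)) this
      (by positivity) (by positivity)
  have hE : t * Y * A⁻¹ + Y₂ * A⁻¹ + S * Y * Y₂ * A⁻¹ ^ 2 ≤ mixedE d m2 := by
    unfold mixedE; nlinarith
  calc ‖(κ : ℂ) * dfamp N M m2 q μ x * conj (famp N M m2 q x')‖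
      ≤ (1 / t + (t * Y * A⁻¹ + Y₂ * A⁻¹ + S * Y * Y₂ * A⁻¹ ^ 2)) / N := by rw [← h3]; exact h1.trans h2
    _ ≤ (1 / t + mixedE d m2) / N := by gcongr

/-- **(B4″) THE DOUBLE-DIFFERENCE PER-FIBRE BOUND**: `‖κ(q) ∇_μA_q(x) conj ∇_νA_q(x′)‖ ≤ E₂/N²` for `q ≠ 0` — no
`1/σ` at all: the doubly differenced Woodbury kernel is `O(1)` per fibre. [cite: King1986, (4.20)–(4.22) p.672] -/
theorem double_term_le (hd : 0 < d) (hN : 1 ≤ N) {a m2 : ℝ} (ha : 0 < a) (hm2 : 0 ≤ m2) {q : Tor M} (hq : q ≠ 0)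
    (μ ν : Fin d) (x x' : Tor (fine N M)) :
    ‖(kap N M a ((N : ℝ) ^ 2) m2 q : ℂ) * dfamp N M m2 q μ x * conj (dfamp N M m2 q ν x')‖
      ≤ doubleE d m2 / (N : ℝ) ^ 2 := by
  have hNr : (0 : ℝ) < N := by exact_mod_cast (show 0 < N by omega)
  set S := lapSym (fine N M) ((N : ℝ) ^ 2) m2 (z N M q) with hS
  set A := ‖u N M (z N M q)‖ with hA
  set κ := kap N M a ((N : ℝ) ^ 2) m2 q with hκ
  set Y₂ := Yoff2 N M m2 q with hY₂
  set t := Real.sqrt S with ht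
  have hSpos : 0 < S := lapSym_z_pos N M hN hm2 hq
  have htpos : 0 < t := Real.sqrt_pos.mpr hSpos
  have htS : t * t = S := Real.mul_self_sqrt hSpos.le
  have hc0 : 0 < (2 / π) ^ d := by positivity
  have hAge : (2 / π) ^ d ≤ A := norm_u_central_ge N M hN q
  have hApos : 0 < A := lt_of_lt_of_le hc0 hAge
  have hAinv : A⁻¹ ≤ (π / 2) ^ d := by
    have := inv_anti₀ hc0 hAge
    rwa [← inv_pow, inv_div] at this
  have hκ0 : 0 ≤ κ := kap_nonneg' N M ha.le hm2 q
  have hκle : κ ≤ S / A ^ 2 := kap_le N M hN ha hm2 hq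
  have hY20 : 0 ≤ Y₂ := Yoff2_nonneg N M m2 q
  have hY2C : Y₂ ≤ aliasC2 d := Yoff2_le N M hd hN hm2 q
  have hSle : S ≤ d * π ^ 2 + m2 := lapSym_z_le N M q
  have hC20 : 0 ≤ aliasC2 d := aliasC2_nonneg d
  have h2t : 2 * t ≤ 1 + (d * π ^ 2 + m2) := by nlinarith [sq_nonneg (t - 1)]
  have hA1 : ‖dfamp N M m2 q μ x‖ ≤ (A / t + Y₂) / N := norm_dfamp_le N M hN hm2 q μ x
  have hA1' : ‖dfamp N M m2 q ν x'‖ ≤ (A / t + Y₂) / N := norm_dfamp_le N M hN hm2 q ν x'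
  have hΦ1 : 0 ≤ (A / t + Y₂) / N := by positivity
  have h1 : ‖(κ : ℂ) * dfamp N M m2 q μ x * conj (dfamp N M m2 q ν x')‖
      ≤ κ * (((A / t + Y₂) / N) * ((A / t + Y₂) / N)) := by
    rw [norm_mul, norm_mul, Complex.norm_conj, Complex.norm_real, Real.norm_eq_abs, abs_of_nonneg hκ0, mul_assoc]
    exact mul_le_mul_of_nonneg_left (mul_le_mul hA1 hA1' (norm_nonneg _) hΦ1) hκ0
  have h2 : κ * (((A / t + Y₂) / N) * ((A / t + Y₂) / N))
      ≤ S / A ^ 2 * (((A / t + Y₂) / N) * ((A / t + Y₂) / N)) :=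
    mul_le_mul_of_nonneg_right hκle (by positivity)
  have h3 : S / A ^ 2 * (((A / t + Y₂) / N) * ((A / t + Y₂) / N))
      = (1 + (2 * t * (Y₂ * A⁻¹) + S * (Y₂ * A⁻¹) ^ 2)) / (N : ℝ) ^ 2 := by
    rw [← htS]
    field_simp
    ring
  have hb2 : Y₂ * A⁻¹ ≤ aliasC2 d * (π / 2) ^ d := mul_le_mul hY2C hAinv (by positivity) (by positivity)
  have hb0 : 0 ≤ Y₂ * A⁻¹ := by positivity
  have hE : 2 * t * (Y₂ * A⁻¹) + S * (Y₂ * A⁻¹) ^ 2 ≤ doubleE d m2 - 1 := by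
    unfold doubleE
    have hsq : (Y₂ * A⁻¹) ^ 2 ≤ (aliasC2 d * (π / 2) ^ d) ^ 2 := pow_le_pow_left₀ hb0 hb2 2
    nlinarith [mul_le_mul h2t hb2 hb0 (by positivity), mul_le_mul hSle hsq (by positivity) (by positivity)]
  calc ‖(κ : ℂ) * dfamp N M m2 q μ x * conj (dfamp N M m2 q ν x')‖
      ≤ (1 + (2 * t * (Y₂ * A⁻¹) + S * (Y₂ * A⁻¹) ^ 2)) / (N : ℝ) ^ 2 := by rw [← h3]; exact h1.trans h2
    _ ≤ (1 + (doubleE d m2 - 1)) / (N : ℝ) ^ 2 := by gcongr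
    _ = doubleE d m2 / (N : ℝ) ^ 2 := by ring

/-- THE DIFFERENCED WOODBURY KERNELS `∇_μ^x R⊥` and `∇_μ^x ∇_ν^{x′} R⊥` (literal lattice differences). [folklore] -/
def dRperp (a m2 : ℝ) (μ : Fin d) (x x' : Tor (fine N M)) : ℂ :=
  Rperp N M a m2 (x + B5Prop11Plancherel.unitVec (fine N M) μ) x' - Rperp N M a m2 x x'

/-- see `dRperp`. [folklore] -/
def ddRperp (a m2 : ℝ) (μ ν : Fin d) (x x' : Tor (fine N M)) : ℂ :=
  Rperp N M a m2 (x + B5Prop11Plancherel.unitVec (fine N M) μ) (x' + B5Prop11Plancherel.unitVec (fine N M) ν)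
    - Rperp N M a m2 (x + B5Prop11Plancherel.unitVec (fine N M) μ) x'
    - Rperp N M a m2 x (x' + B5Prop11Plancherel.unitVec (fine N M) ν) + Rperp N M a m2 x x'

/-- `∇_μ^x R⊥` as the fibre sum `V⁻¹ Σ_{q≠0} κ(q) ∇_μA_q(x) conj A_q(x′)`. [folklore] -/
theorem dRperp_eq (a m2 : ℝ) (μ : Fin d) (x x' : Tor (fine N M)) :
    dRperp N M a m2 μ x x' = ((Fintype.card (Tor (fine N M)) : ℂ))⁻¹ *
      ∑ q ∈ (Finset.univ : Finset (Tor M)).erase 0,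
        (kap N M a ((N : ℝ) ^ 2) m2 q : ℂ) * dfamp N M m2 q μ x * conj (famp N M m2 q x') := by
  unfold dRperp Rperp dfamp
  rw [← mul_sub, ← Finset.sum_sub_distrib]
  congr 1
  exact Finset.sum_congr rfl fun q _ => by ring

/-- `∇_μ^x∇_ν^{x′} R⊥` as the fibre sum `V⁻¹ Σ_{q≠0} κ(q) ∇_μA_q(x) conj ∇_νA_q(x′)`. [folklore] -/
theorem ddRperp_eq (a m2 : ℝ) (μ ν : Fin d) (x x' : Tor (fine N M)) :
    ddRperp N M a m2 μ ν x x' = ((Fintype.card (Tor (fine N M)) : ℂ))⁻¹ *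
      ∑ q ∈ (Finset.univ : Finset (Tor M)).erase 0,
        (kap N M a ((N : ℝ) ^ 2) m2 q : ℂ) * dfamp N M m2 q μ x * conj (dfamp N M m2 q ν x') := by
  unfold ddRperp Rperp dfamp
  simp only [map_sub]
  rw [← mul_sub, ← mul_sub, ← mul_add, ← Finset.sum_sub_distrib, ← Finset.sum_sub_distrib,
    ← Finset.sum_add_distrib]
  congr 1
  exact Finset.sum_congr rfl fun q _ => by ring

end Diff

section Four2

open Literature.Probability.LatticeModels (annulus)
open DyadicShell (Pt supNorm mem_annulus_iff supNorm_le_iff supNorm_eq_zero_iff natAbs_le_supNorm exists_eq_supNorm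
  supNorm_eq_of_mem_sphere sum_Ico_shellSum)
open WindowLog (shellSum)
open TransferUV (card_annulus_succ_four_le)

variable (N M₀ : ℕ) [NeZero N] [NeZero M₀]

/-- Shell count consequence: `Σ_{0 < ‖w‖_∞ ≤ K} ‖w‖_∞⁻¹ ≤ 80·K³`. [folklore] -/
theorem sum_inv_window_le (K : ℕ) :
    ∑ w ∈ annulus 4 0 K, 1 / (supNorm w : ℝ) ≤ 80 * (K : ℝ) ^ 3 := by
  rw [← sum_Ico_shellSum _ (Nat.zero_le K)]
  have hshell : ∀ r ∈ Finset.Ico 0 K, shellSum (fun w : Pt => 1 / (supNorm w : ℝ)) r ≤ 80 * (K : ℝ) ^ 2 := by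
    intro r hr
    have hrK : (r : ℝ) + 1 ≤ K := by exact_mod_cast (Finset.mem_Ico.mp hr).2
    have hr1 : (1 : ℝ) ≤ (r : ℝ) + 1 := by linarith [(Nat.cast_nonneg r : (0 : ℝ) ≤ r)]
    calc shellSum (fun w : Pt => 1 / (supNorm w : ℝ)) r
        = ∑ w ∈ annulus 4 r (r + 1), 1 / ((r : ℝ) + 1) := by
          rw [shellSum]
          refine Finset.sum_congr rfl fun w hw => ?_
          rw [supNorm_eq_of_mem_sphere hw]; push_cast; ring
      _ = ((annulus 4 r (r + 1)).card : ℝ) * (1 / ((r : ℝ) + 1)) := by rw [Finset.sum_const, nsmul_eq_mul]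
      _ ≤ 80 * ((r : ℝ) + 1) ^ 3 * (1 / ((r : ℝ) + 1)) :=
          mul_le_mul_of_nonneg_right (card_annulus_succ_four_le r) (by positivity)
      _ = 80 * ((r : ℝ) + 1) ^ 2 := by field_simp
      _ ≤ 80 * (K : ℝ) ^ 2 := by gcongr
  calc ∑ r ∈ Finset.Ico 0 K, shellSum (fun w : Pt => 1 / (supNorm w : ℝ)) r
      ≤ ∑ _r ∈ Finset.Ico 0 K, 80 * (K : ℝ) ^ 2 := Finset.sum_le_sum hshell
    _ = 80 * (K : ℝ) ^ 3 := by rw [Finset.sum_const, Nat.card_Ico, nsmul_eq_mul, Nat.sub_zero]; ring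

/-- `√σ(z q) ≥ 4‖v(q)‖_∞/M₀`. [folklore] -/
theorem sqrt_lapSym_z_ge (hN : 1 ≤ N) {m2 : ℝ} (hm2 : 0 ≤ m2) (q : Tor (cM M₀)) :
    4 * (supNorm (vOf M₀ q) : ℝ) / (M₀ : ℝ)
      ≤ Real.sqrt (lapSym (fine N (cM M₀)) ((N : ℝ) ^ 2) m2 (z N (cM M₀) q)) := by
  have hM : (0 : ℝ) < M₀ := by exact_mod_cast Nat.pos_of_ne_zero (NeZero.ne M₀)
  have h := lapSym_z_ge_supNorm N M₀ hN hm2 q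
  have e : 4 * (supNorm (vOf M₀ q) : ℝ) / (M₀ : ℝ) = Real.sqrt ((4 * (supNorm (vOf M₀ q) : ℝ) / (M₀ : ℝ)) ^ 2) :=
    (Real.sqrt_sq (by positivity)).symm
  rw [e]
  apply Real.sqrt_le_sqrt
  calc (4 * (supNorm (vOf M₀ q) : ℝ) / (M₀ : ℝ)) ^ 2 = 16 * (supNorm (vOf M₀ q) : ℝ) ^ 2 / (M₀ : ℝ) ^ 2 := by
        field_simp; ring
    _ ≤ _ := h

/-- **The half-power shell sum**: `Σ_{q ≠ 0} 1/√σ(z q) ≤ (5/2)·M₀⁴`. [folklore] -/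
theorem sum_inv_sqrt_lapSym_z_le (hN : 1 ≤ N) {m2 : ℝ} (hm2 : 0 ≤ m2) :
    ∑ q ∈ (Finset.univ : Finset (Tor (cM M₀))).erase 0,
        1 / Real.sqrt (lapSym (fine N (cM M₀)) ((N : ℝ) ^ 2) m2 (z N (cM M₀) q)) ≤ (5 / 2) * (M₀ : ℝ) ^ 4 := by
  have hM : (0 : ℝ) < M₀ := by exact_mod_cast Nat.pos_of_ne_zero (NeZero.ne M₀)
  set g : Pt → ℝ := fun w => 1 / (supNorm w : ℝ) with hg
  have hg0 : ∀ w, 0 ≤ g w := fun w => by positivity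
  have hterm : ∀ q ∈ (Finset.univ : Finset (Tor (cM M₀))).erase 0,
      1 / Real.sqrt (lapSym (fine N (cM M₀)) ((N : ℝ) ^ 2) m2 (z N (cM M₀) q)) ≤ (M₀ : ℝ) / 4 * g (vOf M₀ q) := by
    intro q hq
    have hq0 : q ≠ 0 := Finset.ne_of_mem_erase hq
    have hs : 0 < supNorm (vOf M₀ q) := ((mem_annulus_iff).mp (vOf_mem_annulus M₀ hq0)).1
    have hsR : (0 : ℝ) < supNorm (vOf M₀ q) := by exact_mod_cast hs
    have hlow := sqrt_lapSym_z_ge N M₀ hN hm2 q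
    have hpos : (0 : ℝ) < 4 * (supNorm (vOf M₀ q) : ℝ) / (M₀ : ℝ) := by positivity
    calc 1 / Real.sqrt (lapSym (fine N (cM M₀)) ((N : ℝ) ^ 2) m2 (z N (cM M₀) q))
        ≤ 1 / (4 * (supNorm (vOf M₀ q) : ℝ) / (M₀ : ℝ)) := one_div_le_one_div_of_le hpos hlow
      _ = (M₀ : ℝ) / 4 * g (vOf M₀ q) := by rw [hg]; field_simp
  have hinj : Set.InjOn (vOf M₀) ↑((Finset.univ : Finset (Tor (cM M₀))).erase 0) :=
    fun q _ q' _ h => vOf_injective M₀ h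
  have hsub : ((Finset.univ : Finset (Tor (cM M₀))).erase 0).image (vOf M₀) ⊆ annulus 4 0 (M₀ / 2) := by
    intro w hw
    obtain ⟨q, hq, rfl⟩ := Finset.mem_image.mp hw
    exact vOf_mem_annulus M₀ (Finset.ne_of_mem_erase hq)
  have hhalf : ((M₀ / 2 : ℕ) : ℝ) ≤ (M₀ : ℝ) / 2 := Nat.cast_div_le
  calc ∑ q ∈ (Finset.univ : Finset (Tor (cM M₀))).erase 0,
          1 / Real.sqrt (lapSym (fine N (cM M₀)) ((N : ℝ) ^ 2) m2 (z N (cM M₀) q))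
      ≤ ∑ q ∈ (Finset.univ : Finset (Tor (cM M₀))).erase 0, (M₀ : ℝ) / 4 * g (vOf M₀ q) :=
        Finset.sum_le_sum hterm
    _ = (M₀ : ℝ) / 4 * ∑ w ∈ ((Finset.univ : Finset (Tor (cM M₀))).erase 0).image (vOf M₀), g w := by
        rw [Finset.mul_sum, Finset.sum_image hinj]
    _ ≤ (M₀ : ℝ) / 4 * ∑ w ∈ annulus 4 0 (M₀ / 2), g w :=
        mul_le_mul_of_nonneg_left (Finset.sum_le_sum_of_subset_of_nonneg hsub fun w _ _ => hg0 w)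
          (by positivity)
    _ ≤ (M₀ : ℝ) / 4 * (80 * ((M₀ / 2 : ℕ) : ℝ) ^ 3) := by
        gcongr
        exact sum_inv_window_le (M₀ / 2)
    _ ≤ (M₀ : ℝ) / 4 * (80 * ((M₀ : ℝ) / 2) ^ 3) := by gcongr
    _ = (5 / 2) * (M₀ : ℝ) ^ 4 := by ring

/-- `#{q ≠ 0} ≤ M₀⁴`. [folklore] -/
theorem card_erase_zero_le : (((Finset.univ : Finset (Tor (cM M₀))).erase 0).card : ℝ) ≤ (M₀ : ℝ) ^ 4 := by
  have h1 : ((Finset.univ : Finset (Tor (cM M₀))).erase 0).card ≤ Fintype.card (Tor (cM M₀)) :=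
    (Finset.card_erase_le).trans (Finset.card_univ.le)
  have h2 : Fintype.card (Tor (cM M₀)) = M₀ ^ 4 := by
    simp [Tor, cM, Fintype.card_pi, ZMod.card, Finset.prod_const]
  rw [h2] at h1
  exact_mod_cast h1

/-- the constant `D₁(m²) = 5/2 + E₁(4, m²)`. [folklore] -/
def woodburyD1 (m2 : ℝ) : ℝ := 5 / 2 + mixedE 4 m2

/-- the constant `D₂(m²) = E₂(4, m²)`. [folklore] -/
def woodburyD2 (m2 : ℝ) : ℝ := doubleE 4 m2

/-- **MAIN BOUND, ONE DIFFERENCE (d = 4)**: `‖∇_μ^x R⊥(x,x′)‖ ≤ D₁(m²)/N⁵` for all `x, x′, μ`, uniformly in the volume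
`M₀` and in `a > 0` (lattice units: `D₁L⁻³`, RULING (R7)(i)). [folklore] -/
theorem norm_dRperp_le (hN : 1 ≤ N) {a m2 : ℝ} (ha : 0 < a) (hm2 : 0 ≤ m2) (μ : Fin 4)
    (x x' : Tor (fine N (cM M₀))) :
    ‖dRperp N (cM M₀) a m2 μ x x'‖ ≤ woodburyD1 m2 / (N : ℝ) ^ 5 := by
  have hM : (0 : ℝ) < M₀ := by exact_mod_cast Nat.pos_of_ne_zero (NeZero.ne M₀)
  have hNr : (0 : ℝ) < N := by exact_mod_cast (show 0 < N by omega)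
  have hcard := card_tor_fine N M₀
  have hcardC : ((Fintype.card (Tor (fine N (cM M₀))) : ℂ)) = (((N : ℝ) ^ 4 * (M₀ : ℝ) ^ 4 : ℝ) : ℂ) := by
    rw [← hcard]; push_cast; rfl
  have hE0 : 0 ≤ mixedE 4 m2 := by
    have := aliasC_nonneg 4; have := aliasC2_nonneg 4; unfold mixedE; positivity
  have hsum : ∑ q ∈ (Finset.univ : Finset (Tor (cM M₀))).erase 0,
      ‖(kap N (cM M₀) a ((N : ℝ) ^ 2) m2 q : ℂ) * dfamp N (cM M₀) m2 q μ x * conj (famp N (cM M₀) m2 q x')‖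
        ≤ ((5 / 2) * (M₀ : ℝ) ^ 4 + (M₀ : ℝ) ^ 4 * mixedE 4 m2) / N := by
    calc ∑ q ∈ (Finset.univ : Finset (Tor (cM M₀))).erase 0,
          ‖(kap N (cM M₀) a ((N : ℝ) ^ 2) m2 q : ℂ) * dfamp N (cM M₀) m2 q μ x * conj (famp N (cM M₀) m2 q x')‖
        ≤ ∑ q ∈ (Finset.univ : Finset (Tor (cM M₀))).erase 0,
            (1 / Real.sqrt (lapSym (fine N (cM M₀)) ((N : ℝ) ^ 2) m2 (z N (cM M₀) q)) + mixedE 4 m2) / N :=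
          Finset.sum_le_sum fun q hq =>
            mixed_term_le N (cM M₀) (by norm_num) hN ha hm2 (Finset.ne_of_mem_erase hq) μ x x'
      _ = (∑ q ∈ (Finset.univ : Finset (Tor (cM M₀))).erase 0,
            1 / Real.sqrt (lapSym (fine N (cM M₀)) ((N : ℝ) ^ 2) m2 (z N (cM M₀) q))
          + (((Finset.univ : Finset (Tor (cM M₀))).erase 0).card : ℝ) * mixedE 4 m2) / N := by
          rw [← Finset.sum_div, Finset.sum_add_distrib, Finset.sum_const, nsmul_eq_mul]
      _ ≤ ((5 / 2) * (M₀ : ℝ) ^ 4 + (M₀ : ℝ) ^ 4 * mixedE 4 m2) / N := by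
          gcongr
          · exact sum_inv_sqrt_lapSym_z_le N M₀ hN hm2
          · exact card_erase_zero_le M₀
  rw [dRperp_eq, norm_mul, norm_inv, hcardC, Complex.norm_real, Real.norm_eq_abs, abs_of_pos (by positivity)]
  calc ((N : ℝ) ^ 4 * (M₀ : ℝ) ^ 4)⁻¹ *
        ‖∑ q ∈ (Finset.univ : Finset (Tor (cM M₀))).erase 0,
          (kap N (cM M₀) a ((N : ℝ) ^ 2) m2 q : ℂ) * dfamp N (cM M₀) m2 q μ x * conj (famp N (cM M₀) m2 q x')‖
      ≤ ((N : ℝ) ^ 4 * (M₀ : ℝ) ^ 4)⁻¹ * (((5 / 2) * (M₀ : ℝ) ^ 4 + (M₀ : ℝ) ^ 4 * mixedE 4 m2) / N) := by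
        refine mul_le_mul_of_nonneg_left ((norm_sum_le _ _).trans hsum) (by positivity)
    _ = woodburyD1 m2 / (N : ℝ) ^ 5 := by
        rw [woodburyD1]
        field_simp

/-- **MAIN BOUND, TWO DIFFERENCES (d = 4)**: `‖∇_μ^x∇_ν^{x′} R⊥(x,x′)‖ ≤ D₂(m²)/N⁶` for all `x, x′, μ, ν`, uniformly
in the volume `M₀` and in `a > 0` (lattice units: `D₂L⁻⁴`, RULING (R7)(i)). [folklore] -/
theorem norm_ddRperp_le (hN : 1 ≤ N) {a m2 : ℝ} (ha : 0 < a) (hm2 : 0 ≤ m2) (μ ν : Fin 4)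
    (x x' : Tor (fine N (cM M₀))) :
    ‖ddRperp N (cM M₀) a m2 μ ν x x'‖ ≤ woodburyD2 m2 / (N : ℝ) ^ 6 := by
  have hM : (0 : ℝ) < M₀ := by exact_mod_cast Nat.pos_of_ne_zero (NeZero.ne M₀)
  have hNr : (0 : ℝ) < N := by exact_mod_cast (show 0 < N by omega)
  have hcard := card_tor_fine N M₀
  have hcardC : ((Fintype.card (Tor (fine N (cM M₀))) : ℂ)) = (((N : ℝ) ^ 4 * (M₀ : ℝ) ^ 4 : ℝ) : ℂ) := by
    rw [← hcard]; push_cast; rfl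
  have hE0 : 0 ≤ doubleE 4 m2 := by
    have := aliasC2_nonneg 4; unfold doubleE; positivity
  have hsum : ∑ q ∈ (Finset.univ : Finset (Tor (cM M₀))).erase 0,
      ‖(kap N (cM M₀) a ((N : ℝ) ^ 2) m2 q : ℂ) * dfamp N (cM M₀) m2 q μ x * conj (dfamp N (cM M₀) m2 q ν x')‖
        ≤ (M₀ : ℝ) ^ 4 * (doubleE 4 m2 / (N : ℝ) ^ 2) := by
    calc ∑ q ∈ (Finset.univ : Finset (Tor (cM M₀))).erase 0,
          ‖(kap N (cM M₀) a ((N : ℝ) ^ 2) m2 q : ℂ) * dfamp N (cM M₀) m2 q μ x * conj (dfamp N (cM M₀) m2 q ν x')‖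
        ≤ ∑ q ∈ (Finset.univ : Finset (Tor (cM M₀))).erase 0, doubleE 4 m2 / (N : ℝ) ^ 2 :=
          Finset.sum_le_sum fun q hq =>
            double_term_le N (cM M₀) (by norm_num) hN ha hm2 (Finset.ne_of_mem_erase hq) μ ν x x'
      _ = (((Finset.univ : Finset (Tor (cM M₀))).erase 0).card : ℝ) * (doubleE 4 m2 / (N : ℝ) ^ 2) := by
          rw [Finset.sum_const, nsmul_eq_mul]
      _ ≤ (M₀ : ℝ) ^ 4 * (doubleE 4 m2 / (N : ℝ) ^ 2) :=
          mul_le_mul_of_nonneg_right (card_erase_zero_le M₀) (by positivity)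
  rw [ddRperp_eq, norm_mul, norm_inv, hcardC, Complex.norm_real, Real.norm_eq_abs, abs_of_pos (by positivity)]
  calc ((N : ℝ) ^ 4 * (M₀ : ℝ) ^ 4)⁻¹ *
        ‖∑ q ∈ (Finset.univ : Finset (Tor (cM M₀))).erase 0,
          (kap N (cM M₀) a ((N : ℝ) ^ 2) m2 q : ℂ) * dfamp N (cM M₀) m2 q μ x * conj (dfamp N (cM M₀) m2 q ν x')‖
      ≤ ((N : ℝ) ^ 4 * (M₀ : ℝ) ^ 4)⁻¹ * ((M₀ : ℝ) ^ 4 * (doubleE 4 m2 / (N : ℝ) ^ 2)) := by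
        refine mul_le_mul_of_nonneg_left ((norm_sum_le _ _).trans hsum) (by positivity)
    _ = woodburyD2 m2 / (N : ℝ) ^ 6 := by
        rw [woodburyD2]
        field_simp

end Four2

/-! ## §7 The massless endpoint `m2 = 0` (`a > 0`): the decomposition (E) persists, by continuity

King's fibre inversion `hat_fineOp_inv` is stated for `m2 > 0`.  For `a > 0` the operator `fineOp N M a (N²) 0` is still
invertible and every term of (E) is continuous at `m2 = 0` (all denominators `σ(p)`, `p ≠ 0`, and `1 + aS(q)`, `m2 + a`
stay positive), so (E) at `m2 = 0` follows by uniqueness of limits along `m2 → 0⁺` of the MATRIX identity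
`Gdec(m2) · fineOp(m2) = 1` — which at the same time PROVES the invertibility at `m2 = 0` (no separate kernel argument). -/

section Endpoint

open Filter Topology

variable (N : ℕ) [NeZero N] (M : Fin d → ℕ) [hM : ∀ μ, NeZero (M μ)]

omit [NeZero N] hM in
/-- finite sums of functions continuous at a point are continuous at the point. [folklore] -/
theorem continuousAt_finsetSum {ι X Y : Type*} [TopologicalSpace X] [TopologicalSpace Y] [AddCommMonoid Y]
    [ContinuousAdd Y] (s : Finset ι) {f : ι → X → Y} {x : X} (h : ∀ i ∈ s, ContinuousAt (f i) x) :
    ContinuousAt (fun t => ∑ i ∈ s, f i t) x :=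
  tendsto_finsetSum s fun i hi => h i hi

omit [NeZero N] hM in
/-- `σ(p) > 0` for `p ≠ 0` (`c > 0`, `m2 ≥ 0`): some reduced momentum `p′_μ ∈ [−π,π] ∖ {0}` has `cos p′_μ < 1`. [folklore] -/
theorem lapSym_pos_of_ne_zero (K : Fin d → ℕ) [∀ μ, NeZero (K μ)] {c m2 : ℝ} (hc : 0 < c) (hm2 : 0 ≤ m2)
    {p : Tor K} (hp : p ≠ 0) : 0 < lapSym K c m2 p := by
  obtain ⟨μ, hμ⟩ := Function.ne_iff.mp (B5Prop11Plancherel.sOf_ne_zero K hp)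
  obtain ⟨h1, h2⟩ := abs_le.mp (abs_sOf_le K p μ)
  have hcos : Real.cos (sOf K p μ) < 1 := by
    refine lt_of_le_of_ne (Real.cos_le_one _) fun h => hμ ?_
    exact (Real.cos_eq_one_iff_of_lt_of_lt (by linarith [Real.pi_pos]) (by linarith [Real.pi_pos])).mp h
  have hsum : 2 - 2 * Real.cos (sOf K p μ) ≤ ∑ ν : Fin d, (2 - 2 * Real.cos (sOf K p ν)) :=
    Finset.single_le_sum (f := fun ν => 2 - 2 * Real.cos (sOf K p ν))
      (fun ν _ => by linarith [Real.cos_le_one (sOf K p ν)]) (Finset.mem_univ μ)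
  unfold lapSym
  nlinarith [mul_pos hc (show (0 : ℝ) < 2 - 2 * Real.cos (sOf K p μ) by linarith)]

omit [NeZero N] hM in
/-- `red 0 = 0`. [folklore] -/
theorem red_zero : red N M 0 = 0 := by
  have h := red_z N M (0 : Tor M)
  rwa [z_zero] at h

omit [NeZero N] hM in
/-- the aliases over a nonzero coarse momentum are nonzero fine momenta. [folklore] -/
theorem pOf_ne_zero {q : Tor M} (hq : q ≠ 0) (m : Fin d → Fin N) : pOf N M (m, q) ≠ 0 := by
  intro h
  apply hq
  have := red_pOf N M m q
  rw [h, red_zero] at this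
  exact this.symm

omit [NeZero N] hM in
/-- `m2 ↦ σ(p)` is continuous (affine). [folklore] -/
theorem continuous_lapSym (K : Fin d → ℕ) [∀ μ, NeZero (K μ)] (c : ℝ) (p : Tor K) :
    Continuous fun m2 : ℝ => lapSym K c m2 p := by
  unfold lapSym; fun_prop

/-- `m2 ↦ f/σ(p)` is continuous at `0` for `p ≠ 0`. [folklore] -/
theorem continuousAt_div_lapSym (hN : 1 ≤ N) {p : Tor (fine N M)} (hp : p ≠ 0) (f : ℂ) :
    ContinuousAt (fun m2 : ℝ => f / (lapSym (fine N M) ((N : ℝ) ^ 2) m2 p : ℂ)) 0 := by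
  have hNr : (0 : ℝ) < N := by exact_mod_cast (show 0 < N by omega)
  have hg : ContinuousAt (fun m2 : ℝ => ((lapSym (fine N M) ((N : ℝ) ^ 2) m2 p : ℝ) : ℂ)) 0 :=
    (Complex.continuous_ofReal.comp (continuous_lapSym (fine N M) _ p)).continuousAt
  refine ContinuousAt.div₀ continuousAt_const hg ?_
  have := lapSym_pos_of_ne_zero (fine N M) (c := (N : ℝ) ^ 2) (m2 := 0) (by positivity) le_rfl hp
  exact_mod_cast this.ne'

/-- `m2 ↦ A_q(x)` is continuous at `0` for `q ≠ 0`. [folklore] -/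
theorem continuousAt_famp (hN : 1 ≤ N) {q : Tor M} (hq : q ≠ 0) (x : Tor (fine N M)) :
    ContinuousAt (fun m2 : ℝ => famp N M m2 q x) 0 := by
  have h : (fun m2 : ℝ => famp N M m2 q x) = fun m2 => ∑ m : Fin d → Fin N,
      conj (chi (fine N M) (pOf N M (m, q)) x)
        * (u N M (pOf N M (m, q)) / (lapSym (fine N M) ((N : ℝ) ^ 2) m2 (pOf N M (m, q)) : ℂ)) := by
    funext m2; unfold famp; rw [sum_fib_eq_sum_pOf]
  rw [h]
  exact continuousAt_finsetSum _ fun m _ =>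
    ContinuousAt.mul continuousAt_const (continuousAt_div_lapSym N M hN (pOf_ne_zero N M hq m) _)

/-- `S(q) ≥ 0` also at `m2 ≥ 0` (`c ≥ 0`). [folklore] -/
theorem Sfib_nonneg' {c m2 : ℝ} (hc : 0 ≤ c) (hm2 : 0 ≤ m2) (q : Tor M) : 0 ≤ Sfib N M c m2 q :=
  Finset.sum_nonneg fun p _ => div_nonneg (sq_nonneg _) (hm2.trans (lapSym_ge (fine N M) c m2 hc p))

/-- `m2 ↦ S(q)` is continuous at `0` for `q ≠ 0`. [folklore] -/
theorem continuousAt_Sfib (hN : 1 ≤ N) {q : Tor M} (hq : q ≠ 0) :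
    ContinuousAt (fun m2 : ℝ => Sfib N M ((N : ℝ) ^ 2) m2 q) 0 := by
  have hNr : (0 : ℝ) < N := by exact_mod_cast (show 0 < N by omega)
  have h : (fun m2 : ℝ => Sfib N M ((N : ℝ) ^ 2) m2 q) = fun m2 => ∑ m : Fin d → Fin N,
      ‖u N M (pOf N M (m, q))‖ ^ 2 / lapSym (fine N M) ((N : ℝ) ^ 2) m2 (pOf N M (m, q)) := by
    funext m2; unfold Sfib; rw [sum_fib_eq_sum_pOf]
  rw [h]
  refine continuousAt_finsetSum _ fun m _ => ?_
  refine ContinuousAt.div₀ continuousAt_const (continuous_lapSym (fine N M) _ _).continuousAt ?_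
  exact (lapSym_pos_of_ne_zero (fine N M) (c := (N : ℝ) ^ 2) (m2 := 0) (by positivity) le_rfl
    (pOf_ne_zero N M hq m)).ne'

/-- `m2 ↦ κ(q)` is continuous at `0` for `q ≠ 0`, `a ≥ 0`. [folklore] -/
theorem continuousAt_kap (hN : 1 ≤ N) {a : ℝ} (ha : 0 ≤ a) {q : Tor M} (hq : q ≠ 0) :
    ContinuousAt (fun m2 : ℝ => (kap N M a ((N : ℝ) ^ 2) m2 q : ℂ)) 0 := by
  have hNr : (0 : ℝ) < N := by exact_mod_cast (show 0 < N by omega)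
  have hreal : ContinuousAt (fun m2 : ℝ => kap N M a ((N : ℝ) ^ 2) m2 q) 0 := by
    unfold kap
    refine ContinuousAt.div₀ continuousAt_const
      (ContinuousAt.add continuousAt_const (ContinuousAt.mul continuousAt_const (continuousAt_Sfib N M hN hq))) ?_
    have := Sfib_nonneg' N M (c := (N : ℝ) ^ 2) (m2 := 0) (by positivity) le_rfl q
    show 1 + a * Sfib N M ((N : ℝ) ^ 2) 0 q ≠ 0
    positivity
  exact Complex.continuous_ofReal.continuousAt.comp hreal

/-- `m2 ↦ R⊥(x,x′)` is continuous at `0` for `a ≥ 0`. [folklore] -/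
theorem continuousAt_Rperp (hN : 1 ≤ N) {a : ℝ} (ha : 0 ≤ a) (x x' : Tor (fine N M)) :
    ContinuousAt (fun m2 : ℝ => Rperp N M a m2 x x') 0 := by
  unfold Rperp
  refine ContinuousAt.mul continuousAt_const (continuousAt_finsetSum _ fun q hq => ?_)
  have hq0 : q ≠ 0 := Finset.ne_of_mem_erase hq
  exact ContinuousAt.mul (ContinuousAt.mul (continuousAt_kap N M hN ha hq0) (continuousAt_famp N M hN hq0 x))
    (Complex.continuous_conj.continuousAt.comp (continuousAt_famp N M hN hq0 x'))

/-- `m2 ↦ GfreePerp(w)` is continuous at `0`. [folklore] -/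
theorem continuousAt_GfreePerp (hN : 1 ≤ N) (w : Tor (fine N M)) :
    ContinuousAt (fun m2 : ℝ => GfreePerp N M m2 w) 0 := by
  unfold GfreePerp
  refine ContinuousAt.mul continuousAt_const (continuousAt_finsetSum _ fun p hp => ?_)
  exact continuousAt_div_lapSym N M hN (Finset.ne_of_mem_erase hp) _

/-- THE RIGHT-HAND SIDE OF (E) AS A COMPLEX MATRIX, for any `m2`. [folklore] -/
def Gdec (a m2 : ℝ) : Matrix (Tor (fine N M)) (Tor (fine N M)) ℂ := fun x x' =>
  GfreePerp N M m2 (x' - x) + ((Fintype.card (Tor (fine N M)) : ℂ))⁻¹ * (1 / ((m2 : ℂ) + a)) - Rperp N M a m2 x x'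

/-- entrywise continuity of `Gdec` at `m2 = 0` (`a > 0`). [folklore] -/
theorem continuousAt_Gdec (hN : 1 ≤ N) {a : ℝ} (ha : 0 < a) (x x' : Tor (fine N M)) :
    ContinuousAt (fun m2 : ℝ => Gdec N M a m2 x x') 0 := by
  unfold Gdec
  refine ContinuousAt.sub (ContinuousAt.add ?_ ?_) (continuousAt_Rperp N M hN ha.le x x')
  · exact (continuousAt_GfreePerp N M hN (x' - x))
  · refine ContinuousAt.mul continuousAt_const (ContinuousAt.div₀ continuousAt_const
      (ContinuousAt.add Complex.continuous_ofReal.continuousAt continuousAt_const) ?_)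
    rw [Complex.ofReal_zero, zero_add]
    exact_mod_cast ha.ne'

/-- for `m2 > 0`, `Gdec` IS the (complexified) inverse: (E) entrywise. [folklore] -/
theorem Gdec_eq_map_inv (hN : 1 ≤ N) {a m2 : ℝ} (ha : 0 ≤ a) (hm : 0 < m2) :
    Gdec N M a m2 = ((fineOp N M a ((N : ℝ) ^ 2) m2)⁻¹).map Complex.ofRealHom := by
  ext x x'
  rw [Matrix.map_apply, Complex.ofRealHom_eq_coe, fineOp_inv_decomposition N M hN ha hm x x']
  rfl

/-- for `m2 > 0`: `Gdec(m2) · fineOp(m2) = 1`. [folklore] -/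
theorem Gdec_mul_fineOp (hN : 1 ≤ N) {a m2 : ℝ} (ha : 0 ≤ a) (hm : 0 < m2) :
    Gdec N M a m2 * (fineOp N M a ((N : ℝ) ^ 2) m2).map Complex.ofRealHom = 1 := by
  have hNr : (0 : ℝ) < N := by exact_mod_cast (show 0 < N by omega)
  have hu : IsUnit (fineOp N M a ((N : ℝ) ^ 2) m2).det :=
    (Matrix.isUnit_iff_isUnit_det _).mp (fineOp_isUnit N M ha (by positivity) hm)
  rw [Gdec_eq_map_inv N M hN ha hm, ← Matrix.map_mul, Matrix.nonsing_inv_mul _ hu,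
    Matrix.map_one _ (map_zero _) (map_one _)]

/-- the entries of `m2 ↦ fineOp(m2)` are continuous (affine). [folklore] -/
theorem continuous_fineOp_entry (a c : ℝ) (x y : Tor (fine N M)) :
    Continuous fun m2 : ℝ => ((fineOp N M a c m2 x y : ℝ) : ℂ) := by
  refine Complex.continuous_ofReal.comp ?_
  unfold fineOp lapF
  simp only [Matrix.add_apply, Matrix.smul_apply, smul_eq_mul]
  fun_prop

/-- **`Gdec(0) · fineOp(0) = 1`** for `a > 0`: the limit `m2 → 0⁺` of `Gdec(m2) · fineOp(m2) = 1`. [folklore] -/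
theorem Gdec_mul_fineOp_zero (hN : 1 ≤ N) {a : ℝ} (ha : 0 < a) :
    Gdec N M a 0 * (fineOp N M a ((N : ℝ) ^ 2) 0).map Complex.ofRealHom = 1 := by
  ext x y
  set g : ℝ → ℂ := fun m2 => (Gdec N M a m2 * (fineOp N M a ((N : ℝ) ^ 2) m2).map Complex.ofRealHom) x y
    with hg
  have hcont : ContinuousAt g 0 := by
    have e : g = fun m2 => ∑ x', Gdec N M a m2 x x' * ((fineOp N M a ((N : ℝ) ^ 2) m2 x' y : ℝ) : ℂ) := by
      funext m2; simp only [hg, Matrix.mul_apply, Matrix.map_apply, Complex.ofRealHom_eq_coe]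
    rw [e]
    exact continuousAt_finsetSum _ fun x' _ =>
      ContinuousAt.mul (continuousAt_Gdec N M hN ha x x') (continuous_fineOp_entry N M a _ x' y).continuousAt
  have h1 : Tendsto g (𝓝[>] 0) (𝓝 (g 0)) := hcont.tendsto.mono_left nhdsWithin_le_nhds
  have h2 : Tendsto g (𝓝[>] 0) (𝓝 ((1 : Matrix (Tor (fine N M)) (Tor (fine N M)) ℂ) x y)) := by
    apply tendsto_const_nhds.congr'
    filter_upwards [self_mem_nhdsWithin] with m2 hm2
    show (1 : Matrix (Tor (fine N M)) (Tor (fine N M)) ℂ) x y = g m2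
    rw [hg]
    simp only
    rw [Gdec_mul_fineOp N M hN ha.le (Set.mem_Ioi.mp hm2)]
  have := tendsto_nhds_unique h1 h2
  simpa only [hg] using this

/-- **`fineOp N M a (N²) 0` is invertible for `a > 0`** (massless torus, the block-averaging term lifts the zero
mode). [folklore] -/
theorem isUnit_fineOp_zero (hN : 1 ≤ N) {a : ℝ} (ha : 0 < a) : IsUnit (fineOp N M a ((N : ℝ) ^ 2) 0) := by
  have h := Matrix.isUnit_det_of_left_inverse (Gdec_mul_fineOp_zero N M hN ha)
  rw [← RingHom.mapMatrix_apply, ← RingHom.map_det] at h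
  rw [Matrix.isUnit_iff_isUnit_det, isUnit_iff_ne_zero]
  intro h0
  rw [h0, map_zero] at h
  exact not_isUnit_zero h

/-- **(E₀) THE EXACT DECOMPOSITION AT THE MASSLESS ENDPOINT** (`a > 0`, `N ≥ 1`, any `d`, any periods):
`(fineOp N M a (N²) 0)⁻¹ x x′ = GfreePerp₀(x′ − x) + V⁻¹ a⁻¹ − R⊥₀(x,x′)` with the MASSLESS mean-zero torus Green
function `GfreePerp N M 0` and `R⊥₀ = Rperp N M a 0` — to which (B0)–(B2) apply verbatim (`m2 = 0`). [folklore] -/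
theorem fineOp_inv_zero_decomposition (hN : 1 ≤ N) {a : ℝ} (ha : 0 < a) (x x' : Tor (fine N M)) :
    ((((fineOp N M a ((N : ℝ) ^ 2) 0)⁻¹ x x' : ℝ)) : ℂ)
      = GfreePerp N M 0 (x' - x) + ((Fintype.card (Tor (fine N M)) : ℂ))⁻¹ * (1 / (a : ℂ))
        - Rperp N M a 0 x x' := by
  have hunit := isUnit_fineOp_zero N M hN ha
  have hmap : ((fineOp N M a ((N : ℝ) ^ 2) 0)⁻¹).map Complex.ofRealHom
      * (fineOp N M a ((N : ℝ) ^ 2) 0).map Complex.ofRealHom = 1 := by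
    rw [← Matrix.map_mul, Matrix.nonsing_inv_mul _ ((Matrix.isUnit_iff_isUnit_det _).mp hunit),
      Matrix.map_one _ (map_zero _) (map_one _)]
  have h1 := Matrix.inv_eq_left_inv hmap
  have h2 := Matrix.inv_eq_left_inv (Gdec_mul_fineOp_zero N M hN ha)
  have h3 := congrFun (congrFun (h1.symm.trans h2) x) x'
  rw [Matrix.map_apply, Complex.ofRealHom_eq_coe] at h3
  rw [h3]
  simp only [Gdec, Complex.ofReal_zero, zero_add]

end Endpoint

/-! ## §8 LATTICE UNITS (the cell's normalisation): `Γ_lat = (−Δ₁ + m² + aQ*Q)⁻¹ = N²·G_King` and RULING (R7)(i)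
literally — `|R_W| ≤ D₀L⁻²`, `|∇R_W| ≤ D₁L⁻³`, `|∇R_W∇′| ≤ D₂L⁻⁴` with `L = N` -/

section Lattice

variable (N : ℕ) [NeZero N] (M : Fin d → ℕ) [hM : ∀ μ, NeZero (M μ)]

omit [NeZero N] hM in
/-- `σ_c(c m²; p) = c · σ_1(m²; p)`. [folklore] -/
theorem lapSym_scale (K : Fin d → ℕ) [∀ μ, NeZero (K μ)] (c m2 : ℝ) (p : Tor K) :
    lapSym K c (c * m2) p = c * lapSym K 1 m2 p := by
  unfold lapSym; ring

/-- KING SCALING: `c(−Δ₁) + c m² + (c a)Q*Q = c • (−Δ₁ + m² + aQ*Q)`. [folklore] -/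
theorem fineOp_scale (a c m2 : ℝ) : fineOp N M (c * a) c (c * m2) = c • fineOp N M a 1 m2 := by
  ext z z'
  simp only [fineOp, lapF, Matrix.add_apply, Matrix.smul_apply, smul_eq_mul]
  ring

omit [NeZero N] hM in
/-- `(c • A)⁻¹ = c⁻¹ • A⁻¹` for an invertible real matrix and `c ≠ 0`. [folklore] -/
theorem inv_smul_of_isUnit {n : Type*} [Fintype n] [DecidableEq n] {A : Matrix n n ℝ} (hA : IsUnit A) {c : ℝ}
    (hc : c ≠ 0) : (c • A)⁻¹ = c⁻¹ • A⁻¹ := by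
  apply Matrix.inv_eq_left_inv
  rw [Matrix.smul_mul, Matrix.mul_smul, smul_smul, Matrix.nonsing_inv_mul _ ((Matrix.isUnit_iff_isUnit_det _).mp hA),
    inv_mul_cancel₀ hc, one_smul]

/-- THE UNIT-LATTICE MEAN-ZERO FREE GREEN FUNCTION `C⊥(w) = V⁻¹ Σ_{p ≠ 0} e^{ip·w}/(m² + Σ_μ (2 − 2cos p_μ))`. [folklore] -/
def GfreeLat (m2 : ℝ) (w : Tor (fine N M)) : ℂ :=
  ((Fintype.card (Tor (fine N M)) : ℂ))⁻¹ *
    ∑ p ∈ (Finset.univ : Finset (Tor (fine N M))).erase 0, chi (fine N M) p w / (lapSym (fine N M) 1 m2 p : ℂ)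

/-- THE LATTICE-UNIT WOODBURY CORRECTION `R_W = N² · R⊥(a_K = N²a, m²_K = N²m²)`. [folklore] -/
def RW (a m2 : ℝ) (x x' : Tor (fine N M)) : ℂ :=
  ((N : ℂ)) ^ 2 * Rperp N M ((N : ℝ) ^ 2 * a) ((N : ℝ) ^ 2 * m2) x x'

/-- `N² · GfreePerp(N²m²) = C⊥(m²)`. [folklore] -/
theorem GfreePerp_scale (m2 : ℝ) (w : Tor (fine N M)) :
    ((N : ℂ)) ^ 2 * GfreePerp N M ((N : ℝ) ^ 2 * m2) w = GfreeLat N M m2 w := by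
  have hN' : ((N : ℂ)) ^ 2 ≠ 0 := pow_ne_zero 2 (Nat.cast_ne_zero.mpr (NeZero.ne N))
  unfold GfreePerp GfreeLat
  rw [← mul_assoc, mul_comm (((N : ℂ)) ^ 2), mul_assoc, Finset.mul_sum]
  congr 1
  refine Finset.sum_congr rfl fun p _ => ?_
  rw [lapSym_scale]
  push_cast
  rw [← mul_div_assoc, mul_div_mul_left _ _ hN']

/-- **(E_lat) THE DECOMPOSITION IN LATTICE UNITS** (`a > 0`, `m2 ≥ 0` INCLUDING THE MASSLESS CASE, `N ≥ 1`, any `d`,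
any periods): `Γ_lat(x,x′) := (−Δ₁ + m² + aQ*Q)⁻¹(x,x′) = C⊥(x′ − x) + V⁻¹(m² + a)⁻¹ − R_W(x,x′)`. [folklore] -/
theorem latticeInv_decomposition (hN : 1 ≤ N) {a m2 : ℝ} (ha : 0 < a) (hm2 : 0 ≤ m2) (x x' : Tor (fine N M)) :
    ((((fineOp N M a 1 m2)⁻¹ x x' : ℝ)) : ℂ)
      = GfreeLat N M m2 (x' - x) + ((Fintype.card (Tor (fine N M)) : ℂ))⁻¹ * (1 / ((m2 : ℂ) + a))
        - RW N M a m2 x x' := by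
  have hNr : (0 : ℝ) < N := by exact_mod_cast (show 0 < N by omega)
  have hN2 : ((N : ℝ)) ^ 2 ≠ 0 := by positivity
  have hN2C : ((N : ℂ)) ^ 2 ≠ 0 := pow_ne_zero 2 (Nat.cast_ne_zero.mpr (NeZero.ne N))
  have hscale : fineOp N M a 1 m2 = (((N : ℝ)) ^ 2)⁻¹ • fineOp N M ((N : ℝ) ^ 2 * a) ((N : ℝ) ^ 2) ((N : ℝ) ^ 2 * m2) := by
    rw [fineOp_scale, smul_smul, inv_mul_cancel₀ hN2, one_smul]
  have hunit : IsUnit (fineOp N M ((N : ℝ) ^ 2 * a) ((N : ℝ) ^ 2) ((N : ℝ) ^ 2 * m2)) := by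
    rcases hm2.eq_or_lt with h0 | hpos
    · rw [← h0, mul_zero]; exact isUnit_fineOp_zero N M hN (by positivity)
    · exact fineOp_isUnit N M (by positivity) (by positivity) (by positivity)
  have hinv : (fineOp N M a 1 m2)⁻¹ = ((N : ℝ)) ^ 2 • (fineOp N M ((N : ℝ) ^ 2 * a) ((N : ℝ) ^ 2) ((N : ℝ) ^ 2 * m2))⁻¹ := by
    rw [hscale, inv_smul_of_isUnit hunit (inv_ne_zero hN2), inv_inv]
  have hE : ((((fineOp N M ((N : ℝ) ^ 2 * a) ((N : ℝ) ^ 2) ((N : ℝ) ^ 2 * m2))⁻¹ x x' : ℝ)) : ℂ)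
      = GfreePerp N M ((N : ℝ) ^ 2 * m2) (x' - x)
        + ((Fintype.card (Tor (fine N M)) : ℂ))⁻¹
            * (1 / (((((N : ℝ) ^ 2 * m2 : ℝ)) : ℂ) + ((((N : ℝ) ^ 2 * a : ℝ)) : ℂ)))
        - Rperp N M ((N : ℝ) ^ 2 * a) ((N : ℝ) ^ 2 * m2) x x' := by
    rcases hm2.eq_or_lt with h0 | hpos
    · have h := fineOp_inv_zero_decomposition N M hN (a := (N : ℝ) ^ 2 * a) (by positivity) x x'
      rw [← h0]
      simp only [mul_zero]
      rw [h]
      simp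
    · exact fineOp_inv_decomposition N M hN (by positivity) (by positivity) x x'
  have hma : ((m2 : ℂ) + a) ≠ 0 := by
    have : (0 : ℝ) < m2 + a := by linarith
    exact_mod_cast this.ne'
  have hNC : (N : ℂ) ≠ 0 := Nat.cast_ne_zero.mpr (NeZero.ne N)
  rw [hinv, Matrix.smul_apply, smul_eq_mul, Complex.ofReal_mul, hE]
  unfold RW
  rw [← GfreePerp_scale]
  push_cast
  field_simp

/-- the lattice-unit differenced corrections `∇_μ^x R_W`, `∇_μ^x∇_ν^{x′} R_W`. [folklore] -/
def dRW (a m2 : ℝ) (μ : Fin d) (x x' : Tor (fine N M)) : ℂ :=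
  RW N M a m2 (x + B5Prop11Plancherel.unitVec (fine N M) μ) x' - RW N M a m2 x x'

/-- see `dRW`. [folklore] -/
def ddRW (a m2 : ℝ) (μ ν : Fin d) (x x' : Tor (fine N M)) : ℂ :=
  RW N M a m2 (x + B5Prop11Plancherel.unitVec (fine N M) μ) (x' + B5Prop11Plancherel.unitVec (fine N M) ν)
    - RW N M a m2 (x + B5Prop11Plancherel.unitVec (fine N M) μ) x'
    - RW N M a m2 x (x' + B5Prop11Plancherel.unitVec (fine N M) ν) + RW N M a m2 x x'

/-- `∇R_W = N² ∇R⊥`. [folklore] -/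
theorem dRW_eq (a m2 : ℝ) (μ : Fin d) (x x' : Tor (fine N M)) :
    dRW N M a m2 μ x x' = ((N : ℂ)) ^ 2 * dRperp N M ((N : ℝ) ^ 2 * a) ((N : ℝ) ^ 2 * m2) μ x x' := by
  unfold dRW RW dRperp; ring

/-- `∇∇′R_W = N² ∇∇′R⊥`. [folklore] -/
theorem ddRW_eq (a m2 : ℝ) (μ ν : Fin d) (x x' : Tor (fine N M)) :
    ddRW N M a m2 μ ν x x' = ((N : ℂ)) ^ 2 * ddRperp N M ((N : ℝ) ^ 2 * a) ((N : ℝ) ^ 2 * m2) μ ν x x' := by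
  unfold ddRW RW ddRperp; ring

end Lattice

section LatticeFour

variable (N M₀ : ℕ) [NeZero N] [NeZero M₀]

/-- **(R7)(i), FLAT: `|R_W(x,x′)| ≤ D₀(N²m²)·L⁻²`** with `L = N`, for ALL `x, x′`, every `a > 0`, every volume `M₀`,
every `m2 ≥ 0` (`d = 4`, equal periods). [folklore] -/
theorem norm_RW_le (hN : 1 ≤ N) {a m2 : ℝ} (ha : 0 < a) (hm2 : 0 ≤ m2) (x x' : Tor (fine N (cM M₀))) :
    ‖RW N (cM M₀) a m2 x x'‖ ≤ woodburyD ((N : ℝ) ^ 2 * m2) / (N : ℝ) ^ 2 := by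
  have hNr : (0 : ℝ) < N := by exact_mod_cast (show 0 < N by omega)
  unfold RW
  rw [norm_mul, norm_pow, Complex.norm_natCast]
  have h := norm_Rperp_le N M₀ hN (a := (N : ℝ) ^ 2 * a) (m2 := (N : ℝ) ^ 2 * m2) (by positivity) (by positivity) x x'
  calc (N : ℝ) ^ 2 * ‖Rperp N (cM M₀) ((N : ℝ) ^ 2 * a) ((N : ℝ) ^ 2 * m2) x x'‖
      ≤ (N : ℝ) ^ 2 * (woodburyD ((N : ℝ) ^ 2 * m2) / (N : ℝ) ^ 4) := by gcongr
    _ = woodburyD ((N : ℝ) ^ 2 * m2) / (N : ℝ) ^ 2 := by field_simp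

/-- **(R7)(i), ONE DIFFERENCE: `|∇_μ R_W(x,x′)| ≤ D₁(N²m²)·L⁻³`**. [folklore] -/
theorem norm_dRW_le (hN : 1 ≤ N) {a m2 : ℝ} (ha : 0 < a) (hm2 : 0 ≤ m2) (μ : Fin 4) (x x' : Tor (fine N (cM M₀))) :
    ‖dRW N (cM M₀) a m2 μ x x'‖ ≤ woodburyD1 ((N : ℝ) ^ 2 * m2) / (N : ℝ) ^ 3 := by
  have hNr : (0 : ℝ) < N := by exact_mod_cast (show 0 < N by omega)
  rw [dRW_eq, norm_mul, norm_pow, Complex.norm_natCast]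
  have h := norm_dRperp_le N M₀ hN (a := (N : ℝ) ^ 2 * a) (m2 := (N : ℝ) ^ 2 * m2) (by positivity) (by positivity) μ x x'
  calc (N : ℝ) ^ 2 * ‖dRperp N (cM M₀) ((N : ℝ) ^ 2 * a) ((N : ℝ) ^ 2 * m2) μ x x'‖
      ≤ (N : ℝ) ^ 2 * (woodburyD1 ((N : ℝ) ^ 2 * m2) / (N : ℝ) ^ 5) := by gcongr
    _ = woodburyD1 ((N : ℝ) ^ 2 * m2) / (N : ℝ) ^ 3 := by field_simp

/-- **(R7)(i), TWO DIFFERENCES: `|∇_μ∇′_ν R_W(x,x′)| ≤ D₂(N²m²)·L⁻⁴`**. [folklore] -/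
theorem norm_ddRW_le (hN : 1 ≤ N) {a m2 : ℝ} (ha : 0 < a) (hm2 : 0 ≤ m2) (μ ν : Fin 4)
    (x x' : Tor (fine N (cM M₀))) :
    ‖ddRW N (cM M₀) a m2 μ ν x x'‖ ≤ woodburyD2 ((N : ℝ) ^ 2 * m2) / (N : ℝ) ^ 4 := by
  have hNr : (0 : ℝ) < N := by exact_mod_cast (show 0 < N by omega)
  rw [ddRW_eq, norm_mul, norm_pow, Complex.norm_natCast]
  have h := norm_ddRperp_le N M₀ hN (a := (N : ℝ) ^ 2 * a) (m2 := (N : ℝ) ^ 2 * m2) (by positivity) (by positivity)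
    μ ν x x'
  calc (N : ℝ) ^ 2 * ‖ddRperp N (cM M₀) ((N : ℝ) ^ 2 * a) ((N : ℝ) ^ 2 * m2) μ ν x x'‖
      ≤ (N : ℝ) ^ 2 * (woodburyD2 ((N : ℝ) ^ 2 * m2) / (N : ℝ) ^ 6) := by gcongr
    _ = woodburyD2 ((N : ℝ) ^ 2 * m2) / (N : ℝ) ^ 4 := by field_simp

/-- **THE MASSLESS CASE OF (R7)(i)** (`m2 = 0`, every `a > 0`, every volume): the three bounds with the ABSOLUTE
constants `woodburyD 0`, `woodburyD1 0`, `woodburyD2 0`. [folklore] -/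
theorem norm_RW_zero_le (hN : 1 ≤ N) {a : ℝ} (ha : 0 < a) (μ ν : Fin 4) (x x' : Tor (fine N (cM M₀))) :
    ‖RW N (cM M₀) a 0 x x'‖ ≤ woodburyD 0 / (N : ℝ) ^ 2
      ∧ ‖dRW N (cM M₀) a 0 μ x x'‖ ≤ woodburyD1 0 / (N : ℝ) ^ 3
      ∧ ‖ddRW N (cM M₀) a 0 μ ν x x'‖ ≤ woodburyD2 0 / (N : ℝ) ^ 4 := by
  refine ⟨?_, ?_, ?_⟩
  · simpa using norm_RW_le N M₀ hN ha le_rfl x x'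
  · simpa using norm_dRW_le N M₀ hN ha le_rfl μ x x'
  · simpa using norm_ddRW_le N M₀ hN ha le_rfl μ ν x x'

end LatticeFour

/-! ## §9 Symmetry (v1.1, append-only).  `κ(q)` and `V` are real, so the Woodbury kernel is HERMITIAN:
`R⊥(x′,x) = conj R⊥(x,x′)`, `R_W(x′,x) = conj R_W(x,x′)`.  Consequently the `x′`-DIFFERENCES `∇′_ν R⊥`, `∇′_ν R_W`
(difference in the second argument only) have the same norms as the `x`-differences with the arguments swapped, and
RULING (R7)(i)'s one-difference bound `D₁L⁻³` holds for a difference on EITHER leg (the two-difference bound `∇_μ∇′_ν`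
of §8 already has one difference on each leg; two differences on the same leg are not needed by (W2′) and not stated). -/

section Symmetry

variable (N : ℕ) [NeZero N] (M : Fin d → ℕ) [hM : ∀ μ, NeZero (M μ)]

/-- HERMITIAN SYMMETRY of the Woodbury kernel: `R⊥(x′,x) = conj R⊥(x,x′)` (`κ(q)`, `V` real). [folklore] -/
theorem Rperp_swap (a m2 : ℝ) (x x' : Tor (fine N M)) :
    Rperp N M a m2 x' x = conj (Rperp N M a m2 x x') := by
  unfold Rperp
  simp only [map_mul, map_inv₀, map_natCast, map_sum, Complex.conj_conj, Complex.conj_ofReal]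
  congr 1
  exact Finset.sum_congr rfl fun q _ => by ring

/-- `‖R⊥(x′,x)‖ = ‖R⊥(x,x′)‖`. [folklore] -/
theorem norm_Rperp_swap (a m2 : ℝ) (x x' : Tor (fine N M)) :
    ‖Rperp N M a m2 x' x‖ = ‖Rperp N M a m2 x x'‖ := by
  rw [Rperp_swap, Complex.norm_conj]

/-- `R_W(x′,x) = conj R_W(x,x′)`. [folklore] -/
theorem RW_swap (a m2 : ℝ) (x x' : Tor (fine N M)) :
    RW N M a m2 x' x = conj (RW N M a m2 x x') := by
  unfold RW
  rw [map_mul, map_pow, map_natCast, Rperp_swap]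

/-- THE `x′`-DIFFERENCED WOODBURY KERNEL `∇′_ν R⊥(x,x′) = R⊥(x, x′+e_ν) − R⊥(x,x′)`. [folklore] -/
def dRperp' (a m2 : ℝ) (ν : Fin d) (x x' : Tor (fine N M)) : ℂ :=
  Rperp N M a m2 x (x' + B5Prop11Plancherel.unitVec (fine N M) ν) - Rperp N M a m2 x x'

/-- THE `x′`-DIFFERENCED LATTICE-UNIT CORRECTION `∇′_ν R_W(x,x′) = R_W(x, x′+e_ν) − R_W(x,x′)`. [folklore] -/
def dRW' (a m2 : ℝ) (ν : Fin d) (x x' : Tor (fine N M)) : ℂ :=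
  RW N M a m2 x (x' + B5Prop11Plancherel.unitVec (fine N M) ν) - RW N M a m2 x x'

/-- `∇′_ν R⊥(x,x′) = conj ∇_ν R⊥(x′,x)`. [folklore] -/
theorem dRperp'_eq_conj (a m2 : ℝ) (ν : Fin d) (x x' : Tor (fine N M)) :
    dRperp' N M a m2 ν x x' = conj (dRperp N M a m2 ν x' x) := by
  unfold dRperp' dRperp
  rw [map_sub, ← Rperp_swap, ← Rperp_swap]

/-- `∇′_ν R_W(x,x′) = conj ∇_ν R_W(x′,x)`. [folklore] -/
theorem dRW'_eq_conj (a m2 : ℝ) (ν : Fin d) (x x' : Tor (fine N M)) :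
    dRW' N M a m2 ν x x' = conj (dRW N M a m2 ν x' x) := by
  unfold dRW' dRW
  rw [map_sub, ← RW_swap, ← RW_swap]

/-- `‖∇′_ν R⊥(x,x′)‖ = ‖∇_ν R⊥(x′,x)‖`. [folklore] -/
theorem norm_dRperp'_eq (a m2 : ℝ) (ν : Fin d) (x x' : Tor (fine N M)) :
    ‖dRperp' N M a m2 ν x x'‖ = ‖dRperp N M a m2 ν x' x‖ := by
  rw [dRperp'_eq_conj, Complex.norm_conj]

/-- `‖∇′_ν R_W(x,x′)‖ = ‖∇_ν R_W(x′,x)‖`. [folklore] -/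
theorem norm_dRW'_eq (a m2 : ℝ) (ν : Fin d) (x x' : Tor (fine N M)) :
    ‖dRW' N M a m2 ν x x'‖ = ‖dRW N M a m2 ν x' x‖ := by
  rw [dRW'_eq_conj, Complex.norm_conj]

end Symmetry

section SymmetryFour

variable (N M₀ : ℕ) [NeZero N] [NeZero M₀]

/-- ONE DIFFERENCE ON THE SECOND LEG (d = 4): `‖∇′_ν R⊥(x,x′)‖ ≤ D₁(m²)/N⁵`, uniformly in the volume and in `a > 0`.
[folklore] -/
theorem norm_dRperp'_le (hN : 1 ≤ N) {a m2 : ℝ} (ha : 0 < a) (hm2 : 0 ≤ m2) (ν : Fin 4)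
    (x x' : Tor (fine N (cM M₀))) :
    ‖dRperp' N (cM M₀) a m2 ν x x'‖ ≤ woodburyD1 m2 / (N : ℝ) ^ 5 := by
  rw [norm_dRperp'_eq]
  exact norm_dRperp_le N M₀ hN ha hm2 ν x' x

/-- **(R7)(i), ONE DIFFERENCE ON THE SECOND LEG: `|∇′_ν R_W(x,x′)| ≤ D₁(N²m²)·L⁻³`**. [folklore] -/
theorem norm_dRW'_le (hN : 1 ≤ N) {a m2 : ℝ} (ha : 0 < a) (hm2 : 0 ≤ m2) (ν : Fin 4)
    (x x' : Tor (fine N (cM M₀))) :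
    ‖dRW' N (cM M₀) a m2 ν x x'‖ ≤ woodburyD1 ((N : ℝ) ^ 2 * m2) / (N : ℝ) ^ 3 := by
  rw [norm_dRW'_eq]
  exact norm_dRW_le N M₀ hN ha hm2 ν x' x

/-- **THE MASSLESS CASE, BOTH LEGS** (`m2 = 0`, every `a > 0`, every volume): `|R_W| ≤ D₀/L²`,
`|∇_μ R_W| ≤ D₁/L³`, `|∇′_ν R_W| ≤ D₁/L³`, `|∇_μ∇′_ν R_W| ≤ D₂/L⁴` with the ABSOLUTE constants `woodburyD 0`,
`woodburyD1 0`, `woodburyD2 0` — RULING (R7)(i) for the scalar site model, complete list. [folklore] -/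
theorem norm_RW_zero_le' (hN : 1 ≤ N) {a : ℝ} (ha : 0 < a) (μ ν : Fin 4) (x x' : Tor (fine N (cM M₀))) :
    ‖RW N (cM M₀) a 0 x x'‖ ≤ woodburyD 0 / (N : ℝ) ^ 2
      ∧ ‖dRW N (cM M₀) a 0 μ x x'‖ ≤ woodburyD1 0 / (N : ℝ) ^ 3
      ∧ ‖dRW' N (cM M₀) a 0 ν x x'‖ ≤ woodburyD1 0 / (N : ℝ) ^ 3
      ∧ ‖ddRW N (cM M₀) a 0 μ ν x x'‖ ≤ woodburyD2 0 / (N : ℝ) ^ 4 := by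
  obtain ⟨h0, h1, h2⟩ := norm_RW_zero_le N M₀ hN ha μ ν x x'
  refine ⟨h0, h1, ?_, h2⟩
  simpa using norm_dRW'_le N M₀ hN ha le_rfl ν x x'

end SymmetryFour

end Literature.MathematicalPhysics.QuantumFieldTheory.Balaban1983to89.Beta.WoodburyFibre

end
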